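import Literature.NumberTheory.Sieve.AsymptoticSieveForPrimesS3Minus
import HarnessLib

/-!
# Asymptotic sieve for primes: `S⁺(x; y, z)` — main terms (8.3) and remainder terms (8.4) (proof)

Trunk T-SIEVE. Source: J. Friedlander, H. Iwaniec, *Asymptotic sieve for primes*, Ann. of Math. 148
(1998) 1041–1065 [FriedlanderIwaniecASP1998] (= arXiv:math/9811186), §8 "Estimation of
`S₃(x; Y, Z)`", pp. 1057–1058, displays (8.2)–(8.4). Second of three files discharging
`Literature.NumberTheory.Sieve.fi_asp_S3_estimate` modulo FI (2.4) (see `…S3Minus`).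

## The printed proof (FI §8, second part) and its formalisation

"The contribution to `S₃(x; y, z)` from `λ⁺(c)` is arranged as follows
`S⁺(x; y, z) = ∑_e ∑_{b>sy} μ(b)ρ_{eb} ∑∑_{z<ℓm≤sz} μ(ℓ) log⁺(m/C) a_{ebℓm}
 = ∫_C^x ∑_{b>sy} μ(b) ∑_{ebz<x} ρ_{eb} ∑_{ℓt<sz, ebℓt<x} μ(ℓ) ∑_{m>t, z<ℓm≤sz} a_{ebℓm} dt/t`.
Put `d = ebℓ`, so `d < D` and `d` is squarefree because of (1.16). Here the inner sum is equal to
`A_d(min{x, ebsz}) - A_d(max{dt, ebz})`. Applying (1.7) this inner sum becomes (8.2)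
`g(d) ∑_{dt<n≤x, ebz<n≤ebsz} a_n + r_d(min{x, ebsz}) - r_d(max{dt, ebz})`. We first treat the
contribution to `S⁺(x; y, z)` coming from the main term in (8.2). Recall that `d = ebℓ`. We get a
significant cancellation from summation of `μ(b)`. Note that `b` ranges over the interval
`b_min < b < b_max` where `b_min = max{sy, n/esz}` and `b_max = min{n/ez, n/eℓt}`. This yields
`∑_{(b,eℓ)=1, b_min<b<b_max} μ(b)ρ_{eb} g(ebℓ) = g(eℓ) ∑_{ν₁} μ(ν₁)g(ν₁) ∑_{ν₂∣e} λ_{ν₁ν₂}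
∑_{(b,eℓν₁)=1, b_min<bν₁<b_max} μ(b)g(b)` and here, by (2.4), the inner sum is `O(σ_{eℓν₁}(log x)^{-6})`.
Summing over all the other variables trivially we find that the main term in (8.2) contributes to
`S⁺(x; y, z)` an amount `S*(x; y, z)` which satisfies (8.3) `S*(x; y, z) ≪ A(x)(log x)⁻¹`. The
remainder terms in (8.2) contribute an amount `S'(x; y, z)` satisfying `|S'(x; y, z)| ≤ ∫_C^x ∑^♭_{dt<x}
∑_{k∣d, kz<x} τ₄(k) |r_d(min{x, ksz}) - r_d(max{dt, kz})| dt/t`."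

Formalisation WITHOUT the `t`-integral: both uses of `∫ dt/t` are replaced by discrete partial
summations (in `n` for the remainder terms, in `b` for the main terms); only the `z`-integration of
the two boundary remainder families survives (done in `…S3Assembly`).
* `moebius_mul_lamPlus_mul_a_eq`, `S3plus_eq_sum_k_l`, `sum_m_eq_sum_filter_dvd`:
  `S⁺ = ∑_{k ≤ x} ∑_{ℓ ≤ x/k} M(k)ρ_kμ(ℓ) Q(k,ℓ;z)` with `Q = ∑_{n ≤ x, kℓ∣n} φ_{k,ℓ}(n) a_n`,
  `φ_{k,ℓ}(n) = [kz < n ≤ ksz, n ≤ x] log⁺(n/(kℓC₀))`.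
* (8.2) by Abel summation in `n` (`sum_Icc_sub_mul_eq`, `SieveSequence.remainder_natCast_sub`:
  `r_d(n) - r_d(n-1) = ([d∣n] - g(d)) a_n`): `Q - g(kℓ) ∑_n φ a_n = ∑_n r_d(n)(φ(n) - φ(n+1))`, and
  `|φ(n) - φ(n+1)| ≤ 1/n + (log x)([n = ⌊kz⌋] + [n = ⌊min(ksz,x)⌋])` (`abs_phi_sub_phi_succ_le`), whence
  `SieveSequence.abs_smooth_remainder_le` and `SieveSequence.abs_S3prime_le`:
  `|S'| ≤ ∑^♭_{d≤D} τ₅(d) ∑_{n≤x} |r_d(n)|/n + (log x) ∑^♭_d ∑_{k∣d} τ(k)²(|r_d(min(kz,x))| + |r_d(min(ksz,x))|)`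
  (`∑_{k∣d} τ(k)² = τ₅(d)`, `sum_divisors_card_divisors_sq`). The first sum is the discrete
  `∫ |r_d(t')| dt'/t'` after FI's change `t ↦ t/d`; the second carries FI's boundary terms.
* (8.3): `abs_sum_Ioc_mul_le_of_antitone` (Abel summation against a nonincreasing nonnegative weight),
  `eq_Ioc_of_upper` (the conditions `b > sy`, `n ≤ ebsz` cut a final segment), the `b = ν₂b'`
  substitution (`bprime_summand_eq`) and (2.4) on segments (`abs_sum_Ioc_coprime_moebius_density_le`)
  give `abs_sum_bprime_le`, `abs_sum_bprime_nu_le`, `abs_Bsum_le` and finally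
  `SieveSequence.abs_S3star_le`:
  `|S*| ≤ A(x)(∑^♭_e gτσ)(∑^♭_ℓ gσ)(∑^♭_ν gσ) · 2|K| log x (log a₀)^{-6}`, `a₀ = ⌊sy/Δ⌋`
  (five logarithms against the six saved by (2.4)).

## Mathlib search

Mathlib: `Finset.sum_Ioc_succ_top`, `Nat.le_induction`, `Finset.min'`, `Finset.sum_ite_eq'`,
`Real.monotoneOn_posLog`, `Real.log_le_sub_one_of_pos`; the tree: `…S3Minus`, `…S2`
(`sieveRho_mul_of_squarefree`), `…Tyz` (`sigmaHalf_mul_le`, `Nat.Prime.div_gcd_eq`), `…Inputs`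
(`sigmaHalf`, `one_le_sigmaHalf`). No Abel-summation lemma of this discrete `Ioc` form in the tree
(`lean search 'antitone' Literature/NumberTheory/Sieve`: unrelated hits only).
-/

noncomputable section

open Filter Finset
open scoped ArithmeticFunction.Moebius ArithmeticFunction.vonMangoldt ArithmeticFunction.zeta
  ArithmeticFunction.omega ArithmeticFunction.sigma

namespace Literature.NumberTheory.Sieve

variable {A : SieveSequence}

/-! ### `S⁺` rearranged: `c = ℓ m`, `d = kℓ` -/

/-- `μ(c) λ⁺(c) a_{kc} = ∑_{ℓm = c} μ(ℓ) log⁺(m/C₀) a_{kc}` under (1.16) (FI §8: "`S⁺(x; y, z) =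
∑∑ μ(b)ρ_{eb} ∑∑_{z<ℓm≤sz} μ(ℓ) log⁺(m/C) a_{ebℓm}`": for squarefree `c`, `μ(c)μ(m) = μ(ℓ)` when
`ℓm = c`). [cite: FriedlanderIwaniecASP1998, §8 p. 1057] -/
theorem moebius_mul_lamPlus_mul_a_eq (h116 : ∀ n : ℕ, ¬Squarefree n → A.a n = 0) (C : ℝ)
    (k c : ℕ) :
    (μ c : ℝ) * (∑ m ∈ c.divisors, (μ m : ℝ) * Real.posLog ((m : ℝ) / C)) * A.a (k * c) =
      ∑ p ∈ c.divisorsAntidiagonal, (μ p.1 : ℝ) * Real.posLog ((p.2 : ℝ) / C) * A.a (k * c) := by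
  by_cases hsq : Squarefree (k * c)
  · have hcs : Squarefree c := Squarefree.of_mul_right hsq
    rw [Finset.mul_sum, Finset.sum_mul,
      Nat.sum_divisorsAntidiagonal' (fun ℓ m => (μ ℓ : ℝ) * Real.posLog ((m : ℝ) / C) * A.a (k * c))]
    refine Finset.sum_congr rfl fun m hm => ?_
    have hmc : m ∣ c := Nat.dvd_of_mem_divisors hm
    obtain ⟨ℓ, hℓ⟩ := hmc
    have hm0 : 0 < m := Nat.pos_of_mem_divisors hm
    have hcdiv : c / m = ℓ := by rw [hℓ, Nat.mul_div_cancel_left ℓ hm0]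
    rw [hcdiv]
    have hcs' : Squarefree (m * ℓ) := hℓ ▸ hcs
    have hcop := Nat.coprime_of_squarefree_mul hcs'
    have hμc : (μ c : ℝ) = (μ m : ℝ) * (μ ℓ : ℝ) := by
      rw [hℓ, ArithmeticFunction.isMultiplicative_moebius.map_mul_of_coprime hcop, Int.cast_mul]
    have hμm : (μ m : ℝ) * (μ m : ℝ) = 1 := by
      rw [ArithmeticFunction.moebius_apply_of_squarefree (Squarefree.of_mul_left hcs')]
      push_cast
      rw [← pow_add, ← two_mul, pow_mul]
      norm_num
    rw [hμc]
    linear_combination ((μ ℓ : ℝ) * Real.posLog ((m : ℝ) / C) * A.a (k * c)) * hμm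
  · rw [h116 _ hsq]
    simp

/-- **`S⁺` grouped by `d = kℓ`** (FI §8: "`S⁺(x; y, z) = ∑∑_{b>sy} μ(b)ρ_{eb} ∑∑_{z<ℓm≤sz} μ(ℓ)
log⁺(m/C) a_{ebℓm}`", with `k = eb`): writing `M(k) = ∑_{b∣k} μ(b > sy)`,
`∑_{c ≤ X} ∑_{k ≤ X/c} [z<c≤sz] M(k)ρ_k μ(c)λ⁺(c) a_{kc}
  = ∑_{k ≤ X} ∑_{ℓ ≤ X/k} M(k) ρ_k μ(ℓ) ∑_{m ≤ X/k/ℓ} [z < ℓm ≤ sz] log⁺(m/C₀) a_{kℓm}`.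
[cite: FriedlanderIwaniecASP1998, §8 p. 1057] -/
theorem S3plus_eq_sum_k_l (h116 : ∀ n : ℕ, ¬Squarefree n → A.a n = 0) (Mf : ℕ → ℝ)
    (lam : ℕ → ℤ) (X : ℕ) (C₀ : ℕ) (z sz : ℝ) :
    ∑ c ∈ Icc 1 X, ∑ k ∈ Icc 1 (X / c),
        (if z < (c : ℝ) ∧ (c : ℝ) ≤ sz then
          Mf k * (sieveRho lam k : ℝ) *
            ((μ c : ℝ) * ∑ m ∈ c.divisors, (μ m : ℝ) * Real.posLog ((m : ℝ) / C₀)) * A.a (k * c)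
        else 0) =
      ∑ k ∈ Icc 1 X, ∑ ℓ ∈ Icc 1 (X / k), Mf k * (sieveRho lam k : ℝ) * (μ ℓ : ℝ) *
        ∑ m ∈ Icc 1 (X / k / ℓ), (if z < ((ℓ * m : ℕ) : ℝ) ∧ ((ℓ * m : ℕ) : ℝ) ≤ sz then
          Real.posLog ((m : ℝ) / C₀) * A.a (k * (ℓ * m)) else 0) := by
  classical
  rw [sum_Icc_div_comm]
  refine Finset.sum_congr rfl fun k _ => ?_
  -- rewrite the `c`-summand through the antidiagonal of `c`
  have h1 : ∀ c ∈ Icc 1 (X / k),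
      (if z < (c : ℝ) ∧ (c : ℝ) ≤ sz then
          Mf k * (sieveRho lam k : ℝ) *
            ((μ c : ℝ) * ∑ m ∈ c.divisors, (μ m : ℝ) * Real.posLog ((m : ℝ) / C₀)) * A.a (k * c)
        else 0) =
      ∑ p ∈ c.divisorsAntidiagonal, (if z < ((p.1 * p.2 : ℕ) : ℝ) ∧ ((p.1 * p.2 : ℕ) : ℝ) ≤ sz then
        Mf k * (sieveRho lam k : ℝ) * ((μ p.1 : ℝ) * Real.posLog ((p.2 : ℝ) / C₀) *
          A.a (k * (p.1 * p.2))) else 0) := by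
    intro c _
    split_ifs with hzc
    · rw [mul_assoc (Mf k * (sieveRho lam k : ℝ)), moebius_mul_lamPlus_mul_a_eq h116, Finset.mul_sum]
      refine Finset.sum_congr rfl fun p hp => ?_
      have hpc : p.1 * p.2 = c := (Nat.mem_divisorsAntidiagonal.mp hp).1
      rw [hpc, if_pos hzc]
    · symm
      refine Finset.sum_eq_zero fun p hp => ?_
      have hpc : p.1 * p.2 = c := (Nat.mem_divisorsAntidiagonal.mp hp).1
      rw [hpc, if_neg hzc]
  rw [Finset.sum_congr rfl h1, sum_Icc_sum_divisorsAntidiagonal_eq]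
  -- now `∑ ℓ' ≤ X/k, ∑ m ≤ X/k/ℓ', F (m, ℓ')` with the roles: outer = p.2; we want outer = ℓ = p.1
  rw [sum_Icc_div_comm (fun m ℓ => if z < ((m * ℓ : ℕ) : ℝ) ∧ ((m * ℓ : ℕ) : ℝ) ≤ sz then
        Mf k * (sieveRho lam k : ℝ) * ((μ m : ℝ) * Real.posLog ((ℓ : ℝ) / C₀) *
          A.a (k * (m * ℓ))) else 0) (X / k)]
  refine Finset.sum_congr rfl fun ℓ _ => ?_
  rw [Finset.mul_sum]
  refine Finset.sum_congr rfl fun m _ => ?_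
  split_ifs
  · ring
  · ring

/-- **The `m`-sum as a sum over `n ≡ 0 (mod kℓ)`** (FI §8: "Put `d = ebℓ` … Here the inner sum is
equal to `A_d(min{x, ebsz}) - A_d(max{dt, ebz})`", before the truncation in `t`): for `k, ℓ ≥ 1`,
`0 ≤ z` and `X = ⌊x⌋`,
`∑_{m ≤ X/k/ℓ} [z<ℓm≤sz] log⁺(m/C₀) a_{kℓm} = ∑_{n ≤ X, kℓ ∣ n} φ(n) a_n`,
`φ(n) = [kz < n ≤ ksz, n ≤ x] log⁺(n/(kℓC₀))`. [cite: FriedlanderIwaniecASP1998, §8 (8.2)] -/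
theorem sum_m_eq_sum_filter_dvd (a : ℕ → ℝ) {k ℓ : ℕ} (hk : 1 ≤ k) (hℓ : 1 ≤ ℓ) {x : ℝ} (hx : 0 ≤ x)
    (C₀ : ℕ) (z s : ℝ) :
    ∑ m ∈ Icc 1 (⌊x⌋₊ / k / ℓ), (if z < ((ℓ * m : ℕ) : ℝ) ∧ ((ℓ * m : ℕ) : ℝ) ≤ s * z then
        Real.posLog ((m : ℝ) / C₀) * a (k * (ℓ * m)) else 0) =
      ∑ n ∈ (Icc 1 ⌊x⌋₊).filter (fun n => k * ℓ ∣ n),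
        (if (k : ℝ) * z < n ∧ (n : ℝ) ≤ k * (s * z) ∧ (n : ℝ) ≤ x then
          Real.posLog ((n : ℝ) / ((k * ℓ * C₀ : ℕ) : ℝ)) else 0) * a n := by
  classical
  have hkℓ : 0 < k * ℓ := Nat.mul_pos hk hℓ
  have hk0 : (0 : ℝ) < k := by exact_mod_cast hk
  -- reindex `n = kℓ m`
  refine Finset.sum_nbij' (fun m => k * ℓ * m) (fun n => n / (k * ℓ)) ?_ ?_ ?_ ?_ ?_
  · intro m hm
    obtain ⟨hm1, hmX⟩ := Finset.mem_Icc.mp hm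
    rw [Nat.div_div_eq_div_mul] at hmX
    refine Finset.mem_filter.mpr ⟨Finset.mem_Icc.mpr ⟨Nat.mul_pos hkℓ hm1, ?_⟩, dvd_mul_right _ _⟩
    rw [mul_comm]
    exact (Nat.le_div_iff_mul_le hkℓ).mp hmX
  · intro n hn
    obtain ⟨hn, hdvd⟩ := Finset.mem_filter.mp hn
    obtain ⟨hn1, hnX⟩ := Finset.mem_Icc.mp hn
    refine Finset.mem_Icc.mpr ⟨?_, ?_⟩
    · obtain ⟨q, rfl⟩ := hdvd
      rw [Nat.mul_div_cancel_left q hkℓ]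
      by_contra h
      push Not at h
      have : q = 0 := by omega
      subst this
      simp at hn1
    · rw [Nat.div_div_eq_div_mul]
      exact Nat.div_le_div_right hnX
  · intro m _
    exact Nat.mul_div_cancel_left m hkℓ
  · intro n hn
    obtain ⟨-, hdvd⟩ := Finset.mem_filter.mp hn
    exact Nat.mul_div_cancel' hdvd
  · intro m hm
    have hm1 : 1 ≤ m := (Finset.mem_Icc.mp hm).1
    have e1 : k * (ℓ * m) = k * ℓ * m := by ring
    have hcond : (z < ((ℓ * m : ℕ) : ℝ) ∧ ((ℓ * m : ℕ) : ℝ) ≤ s * z) ↔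
        ((k : ℝ) * z < ((k * ℓ * m : ℕ) : ℝ) ∧ (((k * ℓ * m : ℕ) : ℝ)) ≤ k * (s * z) ∧
          (((k * ℓ * m : ℕ) : ℝ)) ≤ x) := by
      have hcast : ((k * ℓ * m : ℕ) : ℝ) = (k : ℝ) * ((ℓ * m : ℕ) : ℝ) := by push_cast; ring
      rw [hcast]
      constructor
      · rintro ⟨h1, h2⟩
        refine ⟨mul_lt_mul_of_pos_left h1 hk0, mul_le_mul_of_nonneg_left h2 hk0.le, ?_⟩
        have hmX := (Finset.mem_Icc.mp hm).2
        rw [Nat.div_div_eq_div_mul] at hmX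
        have h3 : k * ℓ * m ≤ ⌊x⌋₊ := by
          rw [mul_comm]; exact (Nat.le_div_iff_mul_le hkℓ).mp hmX
        have h4 : ((k * ℓ * m : ℕ) : ℝ) ≤ x := (Nat.cast_le.mpr h3).trans (Nat.floor_le hx)
        calc (k : ℝ) * ((ℓ * m : ℕ) : ℝ) = ((k * ℓ * m : ℕ) : ℝ) := by push_cast; ring
          _ ≤ x := h4
      · rintro ⟨h1, h2, -⟩
        exact ⟨lt_of_mul_lt_mul_left h1 hk0.le, le_of_mul_le_mul_left h2 hk0⟩
    have hpl : Real.posLog ((m : ℝ) / C₀) = Real.posLog (((k * ℓ * m : ℕ) : ℝ) / ((k * ℓ * C₀ : ℕ) : ℝ)) := by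
      rcases Nat.eq_zero_or_pos C₀ with hC | hC
      · subst hC; simp
      · congr 1
        have : ((k * ℓ * C₀ : ℕ) : ℝ) ≠ 0 := by positivity
        have hkℓ0 : ((k * ℓ : ℕ) : ℝ) ≠ 0 := by positivity
        rw [div_eq_div_iff (by positivity) this]
        push_cast
        ring
    rw [e1]
    by_cases hc : z < ((ℓ * m : ℕ) : ℝ) ∧ ((ℓ * m : ℕ) : ℝ) ≤ s * z
    · rw [if_pos hc, if_pos (hcond.mp hc), hpl]
    · rw [if_neg hc, if_neg (fun h => hc (hcond.mpr h)), zero_mul]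

/-! ### (1.7) on the smooth sums: discrete partial summation in `n` -/

/-- **Discrete Abel summation**: if `u(0) = 0` then
`∑_{n ≤ X} (u(n) - u(n-1)) φ(n) = ∑_{n ≤ X} u(n) (φ(n) - φ(n+1)) + u(X) φ(X+1)`. [folklore] -/
theorem sum_Icc_sub_mul_eq (u φ : ℕ → ℝ) (hu : u 0 = 0) (X : ℕ) :
    ∑ n ∈ Icc 1 X, (u n - u (n - 1)) * φ n =
      ∑ n ∈ Icc 1 X, u n * (φ n - φ (n + 1)) + u X * φ (X + 1) := by
  induction X with
  | zero => simp [hu]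
  | succ X ih =>
    rw [Finset.sum_Icc_succ_top (by omega), Finset.sum_Icc_succ_top (by omega), ih,
      Nat.add_sub_cancel]
    ring

namespace SieveSequence

/-- `A_d(n) - A_d(n-1) = [d ∣ n] a_n` for `n ≥ 1`. [folklore] -/
theorem congrSum_natCast_sub (A : SieveSequence) (d : ℕ) {n : ℕ} (hn : 1 ≤ n) :
    A.congrSum d n - A.congrSum d ((n - 1 : ℕ) : ℝ) = if d ∣ n then A.a n else 0 := by
  rw [congrSum, congrSum, Nat.floor_natCast, Nat.floor_natCast, Finset.sum_filter, Finset.sum_filter]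
  obtain ⟨m, rfl⟩ : ∃ m, n = m + 1 := ⟨n - 1, by omega⟩
  rw [Nat.add_sub_cancel, Finset.sum_Ioc_succ_top (Nat.zero_le m)]
  ring

/-- Under the size normalisation `A(t) = ∑_{n ≤ t} a_n`: `r_d(n) - r_d(n-1) = ([d ∣ n] - g(d)) a_n`
for `n ≥ 1`, and `r_d(0) = 0`. [cite: FriedlanderIwaniecASP1998, (1.7)] -/
theorem remainder_natCast_sub (A : SieveSequence) (hsize : ∀ t, A.size t = A.congrSum 1 t) (d : ℕ)
    {n : ℕ} (hn : 1 ≤ n) :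
    A.remainder d n - A.remainder d ((n - 1 : ℕ) : ℝ) =
      ((if d ∣ n then 1 else 0) - A.density d) * A.a n := by
  rw [remainder, remainder, hsize, hsize]
  have h1 := A.congrSum_natCast_sub d hn
  have h2 := A.congrSum_natCast_sub 1 hn
  rw [if_pos (one_dvd n)] at h2
  split_ifs at h1 ⊢ with hdn
  · linear_combination h1 - A.density d * h2
  · linear_combination h1 - A.density d * h2

/-- `r_d(0) = 0` under the size normalisation. [folklore] -/
theorem remainder_zero (A : SieveSequence) (hsize : ∀ t, A.size t = A.congrSum 1 t) (d : ℕ) :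
    A.remainder d ((0 : ℕ) : ℝ) = 0 := by
  rw [remainder, hsize, congrSum, congrSum]
  simp

/-- `r_d(t)` depends only on `⌊t⌋`: `r_d(⌊t⌋) = r_d(t)` for `t ≥ 0` (size normalisation). [folklore] -/
theorem remainder_natFloor (A : SieveSequence) (hsize : ∀ t, A.size t = A.congrSum 1 t) (d : ℕ)
    (t : ℝ) : A.remainder d (⌊t⌋₊ : ℝ) = A.remainder d t := by
  rw [remainder, remainder, hsize, hsize, congrSum, congrSum, congrSum, congrSum, Nat.floor_natCast]

end SieveSequence

/-- `log⁺` is `1`-Lipschitz in the logarithmic variable: `log⁺ b - log⁺ a ≤ log b - log a` for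
`0 < a ≤ b`. [folklore] -/
theorem posLog_sub_posLog_le {a b : ℝ} (ha : 0 < a) (hab : a ≤ b) :
    Real.posLog b - Real.posLog a ≤ Real.log b - Real.log a := by
  have hlog : Real.log a ≤ Real.log b := Real.log_le_log ha hab
  simp only [Real.posLog, max_def]
  split_ifs <;> linarith

/-- `log⁺(t) ≤ log x` for `0 ≤ t ≤ x`, `1 ≤ x`. [folklore] -/
theorem posLog_le_log {t x : ℝ} (ht : 0 ≤ t) (htx : t ≤ x) (hx : 1 ≤ x) : Real.posLog t ≤ Real.log x := by
  have h := Real.monotoneOn_posLog ht (le_trans ht htx) htx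
  have hx' : Real.posLog x = Real.log x :=
    Real.posLog_eq_log (by rw [abs_of_nonneg (by linarith)]; exact hx)
  rw [hx'] at h
  exact h

/-- **The variation of the smooth cutoff** `φ(n) = [kz < n ≤ ksz, n ≤ x] log⁺(n/R)` (`R ≥ 1`, `x ≥ 1`):
`|φ(n) - φ(n+1)| ≤ 1/n + (log x)([n = ⌊kz⌋] + [n = ⌊min(ksz, x)⌋])` for `n ≥ 1` (inside the range
`|log⁺(n/R) - log⁺((n+1)/R)| ≤ log(1 + 1/n) ≤ 1/n`; at the two boundary integers one of `φ(n)`,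
`φ(n+1)` vanishes and the other is `≤ log x`). [cite: FriedlanderIwaniecASP1998, §8 (8.2)] -/
theorem abs_phi_sub_phi_succ_le {R x lo hi' : ℝ} (hR : 1 ≤ R) (hx : 1 ≤ x) (hlo : 0 ≤ lo)
    {n : ℕ} (hn : 1 ≤ n) :
    |(if lo < (n : ℝ) ∧ (n : ℝ) ≤ hi' ∧ (n : ℝ) ≤ x then Real.posLog ((n : ℝ) / R) else 0) -
      (if lo < ((n + 1 : ℕ) : ℝ) ∧ ((n + 1 : ℕ) : ℝ) ≤ hi' ∧ ((n + 1 : ℕ) : ℝ) ≤ x then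
        Real.posLog (((n + 1 : ℕ) : ℝ) / R) else 0)| ≤
      1 / n + Real.log x *
        ((if n = ⌊lo⌋₊ then 1 else 0) + (if n = ⌊min hi' x⌋₊ then 1 else 0)) := by
  have hn0 : (0 : ℝ) < n := by exact_mod_cast hn
  have hR0 : 0 < R := by linarith
  have hlogx : 0 ≤ Real.log x := Real.log_nonneg hx
  have hW : ∀ m : ℕ, (m : ℝ) ≤ x → Real.posLog ((m : ℝ) / R) ≤ Real.log x := fun m hm =>
    posLog_le_log (by positivity) ((div_le_self (Nat.cast_nonneg m) hR).trans hm) hx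
  have hinv : 0 ≤ 1 / (n : ℝ) := by positivity
  have hind0 : 0 ≤ Real.log x *
      ((if n = ⌊lo⌋₊ then 1 else 0) + (if n = ⌊min hi' x⌋₊ then (1 : ℝ) else 0)) := by
    refine mul_nonneg hlogx (add_nonneg ?_ ?_) <;> split_ifs <;> norm_num
  by_cases h1 : lo < (n : ℝ) ∧ (n : ℝ) ≤ hi' ∧ (n : ℝ) ≤ x
  · by_cases h2 : lo < ((n + 1 : ℕ) : ℝ) ∧ ((n + 1 : ℕ) : ℝ) ≤ hi' ∧ ((n + 1 : ℕ) : ℝ) ≤ x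
    · -- both inside: Lipschitz bound
      rw [if_pos h1, if_pos h2]
      have hle : (n : ℝ) / R ≤ ((n + 1 : ℕ) : ℝ) / R :=
        div_le_div_of_nonneg_right (by push_cast; linarith) hR0.le
      have hmono := Real.monotoneOn_posLog (show 0 ≤ (n : ℝ) / R by positivity)
        (show 0 ≤ ((n + 1 : ℕ) : ℝ) / R by positivity) hle
      have hlip := posLog_sub_posLog_le (show 0 < (n : ℝ) / R by positivity) hle
      have hlogq : Real.log (((n + 1 : ℕ) : ℝ) / R) - Real.log ((n : ℝ) / R) ≤ 1 / n := by
        rw [← Real.log_div (by positivity) (by positivity), div_div_div_cancel_right₀ hR0.ne']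
        have : ((n + 1 : ℕ) : ℝ) / n = 1 + 1 / n := by
          push_cast; field_simp
        rw [this]
        have h := Real.log_le_sub_one_of_pos (show 0 < 1 + 1 / (n : ℝ) by positivity)
        linarith
      rw [abs_sub_comm, abs_of_nonneg (by linarith)]
      linarith
    · -- `n` inside, `n+1` outside: then `n = ⌊min hi' x⌋`
      rw [if_pos h1, if_neg h2, sub_zero, abs_of_nonneg Real.posLog_nonneg]
      have hn_eq : n = ⌊min hi' x⌋₊ := by
        obtain ⟨h1a, h1b, h1c⟩ := h1
        have hnot : ¬(((n + 1 : ℕ) : ℝ) ≤ hi' ∧ ((n + 1 : ℕ) : ℝ) ≤ x) := by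
          rintro ⟨hb, hc⟩
          exact h2 ⟨by push_cast; linarith, hb, hc⟩
        have hle : (n : ℝ) ≤ min hi' x := le_min h1b h1c
        have hlt : min hi' x < (n : ℝ) + 1 := by
          by_contra hcon
          push Not at hcon
          exact hnot ⟨by push_cast; exact le_trans hcon (min_le_left _ _),
            by push_cast; exact le_trans hcon (min_le_right _ _)⟩
        exact ((Nat.floor_eq_iff (le_trans hn0.le hle)).mpr ⟨hle, hlt⟩).symm
      rw [if_pos hn_eq]
      have := hW n h1.2.2
      have h01 : (0 : ℝ) ≤ (if n = ⌊lo⌋₊ then 1 else 0) := by split_ifs <;> norm_num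
      nlinarith
  · by_cases h2 : lo < ((n + 1 : ℕ) : ℝ) ∧ ((n + 1 : ℕ) : ℝ) ≤ hi' ∧ ((n + 1 : ℕ) : ℝ) ≤ x
    · -- `n` outside, `n+1` inside: then `n = ⌊lo⌋`
      rw [if_neg h1, if_pos h2, zero_sub, abs_neg, abs_of_nonneg Real.posLog_nonneg]
      have hn_eq : n = ⌊lo⌋₊ := by
        obtain ⟨h2a, h2b, h2c⟩ := h2
        have hnlo : ¬(lo < (n : ℝ)) := by
          intro hcon
          exact h1 ⟨hcon, by push_cast at h2b; linarith, by push_cast at h2c; linarith⟩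
        push Not at hnlo
        have hlt : lo < (n : ℝ) + 1 := by push_cast at h2a; exact h2a
        exact ((Nat.floor_eq_iff hlo).mpr ⟨hnlo, hlt⟩).symm
      rw [if_pos hn_eq]
      have := hW (n + 1) h2.2.2
      have h01 : (0 : ℝ) ≤ (if n = ⌊min hi' x⌋₊ then 1 else 0) := by split_ifs <;> norm_num
      nlinarith
    · rw [if_neg h1, if_neg h2, sub_zero, abs_zero]
      exact add_nonneg hinv hind0

/-- **The remainder terms of one `d = kℓ`** (FI §8, (8.2): "Applying (1.7) this inner sum becomes
`g(d) ∑ a_n + r_d(min{x, ebsz}) - r_d(max{dt, ebz})`", in discrete partial-summation form):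
with `φ(n) = [kz < n ≤ ksz, n ≤ x] log⁺(n/R)` (`R ≥ 1`), `x ≥ 1`, and the size normalisation,
`|∑_{n ≤ x, d∣n} φ(n) a_n - g(d) ∑_{n ≤ x} φ(n) a_n|
  ≤ ∑_{n ≤ x} |r_d(n)|/n + (log x)(|r_d(min(kz, x))| + |r_d(min(ksz, x))|)`.
[cite: FriedlanderIwaniecASP1998, §8 (8.2)] -/
theorem SieveSequence.abs_smooth_remainder_le (A : SieveSequence)
    (hsize : ∀ t, A.size t = A.congrSum 1 t) (d : ℕ) {R x lo : ℝ} (hi' : ℝ) (hR : 1 ≤ R)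
    (hx : 1 ≤ x) (hlo : 0 ≤ lo) :
    |∑ n ∈ (Icc 1 ⌊x⌋₊).filter (fun n => d ∣ n),
        (if lo < (n : ℝ) ∧ (n : ℝ) ≤ hi' ∧ (n : ℝ) ≤ x then Real.posLog ((n : ℝ) / R) else 0) * A.a n -
      A.density d * ∑ n ∈ Icc 1 ⌊x⌋₊,
        (if lo < (n : ℝ) ∧ (n : ℝ) ≤ hi' ∧ (n : ℝ) ≤ x then Real.posLog ((n : ℝ) / R) else 0) * A.a n|
      ≤ ∑ n ∈ Icc 1 ⌊x⌋₊, |A.remainder d n| / n +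
        Real.log x * (|A.remainder d (min lo x)| + |A.remainder d (min hi' x)|) := by
  classical
  set X := ⌊x⌋₊ with hX
  set φ : ℕ → ℝ := fun n =>
    if lo < (n : ℝ) ∧ (n : ℝ) ≤ hi' ∧ (n : ℝ) ≤ x then Real.posLog ((n : ℝ) / R) else 0 with hφ
  set u : ℕ → ℝ := fun n => A.remainder d n with hu
  have hx0 : 0 ≤ x := by linarith
  have hlogx : 0 ≤ Real.log x := Real.log_nonneg hx
  -- Step 1: the left side is `∑ (u n - u (n-1)) φ n`
  have hL : ∑ n ∈ (Icc 1 X).filter (fun n => d ∣ n), φ n * A.a n -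
      A.density d * ∑ n ∈ Icc 1 X, φ n * A.a n = ∑ n ∈ Icc 1 X, (u n - u (n - 1)) * φ n := by
    rw [Finset.sum_filter, Finset.mul_sum, ← Finset.sum_sub_distrib]
    refine Finset.sum_congr rfl fun n hn => ?_
    have hn1 : 1 ≤ n := (Finset.mem_Icc.mp hn).1
    rw [hu]
    dsimp only
    rw [A.remainder_natCast_sub hsize d hn1]
    split_ifs <;> ring
  have hφX : φ (X + 1) = 0 := by
    rw [hφ]
    dsimp only
    rw [if_neg]
    rintro ⟨-, -, h3⟩
    have := Nat.lt_floor_add_one x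
    push_cast at h3
    linarith
  rw [hL, sum_Icc_sub_mul_eq u φ (A.remainder_zero hsize d) X, hφX, mul_zero, add_zero]
  -- Step 2: termwise bound
  have hterm : ∀ n ∈ Icc 1 X, |u n * (φ n - φ (n + 1))| ≤
      |A.remainder d n| / n + Real.log x *
        (|A.remainder d n| * (if n = ⌊lo⌋₊ then 1 else 0) +
          |A.remainder d n| * (if n = ⌊min hi' x⌋₊ then 1 else 0)) := by
    intro n hn
    have hn1 : 1 ≤ n := (Finset.mem_Icc.mp hn).1
    rw [abs_mul]
    have h := abs_phi_sub_phi_succ_le hR hx hlo hn1 (R := R) (hi' := hi')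
    calc |u n| * |φ n - φ (n + 1)|
        ≤ |u n| * (1 / n + Real.log x *
            ((if n = ⌊lo⌋₊ then 1 else 0) + (if n = ⌊min hi' x⌋₊ then 1 else 0))) :=
          mul_le_mul_of_nonneg_left h (abs_nonneg _)
      _ = _ := by rw [hu]; ring
  refine (Finset.abs_sum_le_sum_abs _ _).trans ((Finset.sum_le_sum hterm).trans ?_)
  rw [Finset.sum_add_distrib, ← Finset.mul_sum, Finset.sum_add_distrib]
  refine add_le_add le_rfl (mul_le_mul_of_nonneg_left (add_le_add ?_ ?_) hlogx)
  · -- the `⌊lo⌋` boundary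
    have hrw : ∀ n ∈ Icc 1 X, |A.remainder d n| * (if n = ⌊lo⌋₊ then (1 : ℝ) else 0) =
        if n = ⌊lo⌋₊ then |A.remainder d n| else 0 := fun n _ => by split_ifs <;> simp
    rw [Finset.sum_congr rfl hrw, Finset.sum_ite_eq']
    split_ifs with hmem
    · have hle : ⌊lo⌋₊ ≤ X := (Finset.mem_Icc.mp hmem).2
      rcases le_or_gt lo x with hlx | hlx
      · rw [min_eq_left hlx, A.remainder_natFloor hsize d lo]
      · have hge : X ≤ ⌊lo⌋₊ := Nat.floor_le_floor hlx.le
        rw [min_eq_right hlx.le, le_antisymm hle hge, hX, A.remainder_natFloor hsize d x]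
    · exact abs_nonneg _
  · -- the `⌊min hi' x⌋` boundary
    have hrw : ∀ n ∈ Icc 1 X, |A.remainder d n| * (if n = ⌊min hi' x⌋₊ then (1 : ℝ) else 0) =
        if n = ⌊min hi' x⌋₊ then |A.remainder d n| else 0 := fun n _ => by split_ifs <;> simp
    rw [Finset.sum_congr rfl hrw, Finset.sum_ite_eq']
    split_ifs with hmem
    · rw [A.remainder_natFloor hsize d (min hi' x)]
    · exact abs_nonneg _

/-! ### The remainder terms `S'(x; y, z)`, pointwise in `z` -/

/-- `∑_{k ∣ d} τ(k)² = τ₅(d)` for squarefree `d` (`4^{ω(k)}` summed over `k ∣ d` is `5^{ω(d)}`).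
[folklore] -/
theorem sum_divisors_card_divisors_sq {d : ℕ} (hd : Squarefree d) :
    ∑ k ∈ d.divisors, ((k.divisors.card : ℝ)) ^ 2 = (divisorCountK 5 d : ℝ) := by
  rw [show (5 : ℕ) = 4 + 1 from rfl, divisorCountK_succ_apply]
  push_cast
  refine Finset.sum_congr rfl fun k hk => ?_
  have hksq : Squarefree k := hd.squarefree_of_dvd (Nat.dvd_of_mem_divisors hk)
  rw [card_divisors_of_squarefree hksq, divisorCountK_apply_of_squarefree 4 hksq,
    ← card_primeFactors_eq_cardDistinctFactors]
  push_cast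
  rw [← pow_mul, mul_comm, pow_mul]
  norm_num

/-- If `R ≥ x` then the smooth cutoff `[…] log⁺(n/R)` vanishes for all `n ≤ x`. [folklore] -/
theorem phi_eq_zero_of_le {R x lo hi' : ℝ} (hR : 0 < R) (hxR : x ≤ R) (n : ℕ) :
    (if lo < (n : ℝ) ∧ (n : ℝ) ≤ hi' ∧ (n : ℝ) ≤ x then Real.posLog ((n : ℝ) / R) else 0) = 0 := by
  split_ifs with h
  · refine (Real.posLog_eq_zero_iff _).mpr ?_
    rw [abs_of_nonneg (by positivity), div_le_one hR]
    exact h.2.2.trans hxR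
  · rfl

/-- Reindexing a sum over `k ≤ X`, `ℓ ≤ X/k` by `d = kℓ ≤ X` and `k ∣ d`. [folklore] -/
theorem sum_Icc_sum_Icc_div_eq_sum_sum_divisors {M : Type*} [AddCommMonoid M] (G : ℕ → ℕ → M)
    (X : ℕ) :
    ∑ k ∈ Icc 1 X, ∑ ℓ ∈ Icc 1 (X / k), G k (k * ℓ) = ∑ d ∈ Icc 1 X, ∑ k ∈ d.divisors, G k d := by
  rw [← sum_Icc_sum_divisorsAntidiagonal_eq (fun p : ℕ × ℕ => G p.2 (p.2 * p.1)) X]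
  refine Finset.sum_congr rfl fun d _ => ?_
  rw [Nat.sum_divisorsAntidiagonal' (fun a b => G b (b * a))]
  refine Finset.sum_congr rfl fun k hk => ?_
  rw [Nat.mul_div_cancel' (Nat.dvd_of_mem_divisors hk)]

namespace SieveSequence

/-- **The remainder terms `S'(x; y, z)` of `S⁺`, pointwise in `z`** (FI §8: "The remainder terms in
(8.2) contribute an amount `S'(x; y, z)` satisfying `|S'(x; y, z)| ≤ ∫_C^x ∑^♭_{dt<x} ∑_{k∣d, kz<x}
τ₄(k) |r_d(min{x, ksz}) - r_d(max{dt, kz})| dt/t`"), discrete form: with `|M(k)| ≤ τ(k)`,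
`0 ≤ ρ_k ≤ τ(k)`, `τ(k)² = τ₄(k)`, `∑_{k∣d} τ₄(k) = τ₅(d)`, and every `d` with `dC₀ < x` at most `D_n`,
`|S'(x; y, z)| ≤ ∑^♭_{d ≤ D_n} τ₅(d) ∑_{n ≤ x} |r_d(n)|/n
  + (log x) ∑^♭_{d ≤ D_n} ∑_{k∣d} τ(k)² (|r_d(min(kz, x))| + |r_d(min(ksz, x))|)`.
[cite: FriedlanderIwaniecASP1998, §8 (8.4)] -/
theorem abs_S3prime_le (A : SieveSequence) (hsize : ∀ t, A.size t = A.congrSum 1 t)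
    {P L : ℝ} {lam : ℕ → ℤ} (hw : IsUpperSieveWeights P L lam) {x : ℝ} (hx : 1 ≤ x) {z : ℝ}
    (s : ℝ) (hz : 0 ≤ z) {C₀ : ℕ} (hC : 1 ≤ C₀) {Dn : ℕ}
    (hD : ∀ d : ℕ, ((d * C₀ : ℕ) : ℝ) < x → d ≤ Dn) (Mf : ℕ → ℝ)
    (hMf : ∀ k, |Mf k| ≤ (k.divisors.card : ℝ)) :
    |∑ k ∈ Icc 1 ⌊x⌋₊, ∑ ℓ ∈ Icc 1 (⌊x⌋₊ / k),
        (if Squarefree (k * ℓ) then Mf k * (sieveRho lam k : ℝ) * (μ ℓ : ℝ) *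
          (∑ n ∈ (Icc 1 ⌊x⌋₊).filter (fun n => k * ℓ ∣ n),
              (if (k : ℝ) * z < n ∧ (n : ℝ) ≤ k * (s * z) ∧ (n : ℝ) ≤ x then
                Real.posLog ((n : ℝ) / ((k * ℓ * C₀ : ℕ) : ℝ)) else 0) * A.a n -
            A.density (k * ℓ) * ∑ n ∈ Icc 1 ⌊x⌋₊,
              (if (k : ℝ) * z < n ∧ (n : ℝ) ≤ k * (s * z) ∧ (n : ℝ) ≤ x then
                Real.posLog ((n : ℝ) / ((k * ℓ * C₀ : ℕ) : ℝ)) else 0) * A.a n)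
        else 0)| ≤
      ∑ d ∈ (Icc 1 Dn).filter Squarefree, (divisorCountK 5 d : ℝ) *
          ∑ n ∈ Icc 1 ⌊x⌋₊, |A.remainder d n| / n +
        Real.log x * ∑ d ∈ (Icc 1 Dn).filter Squarefree, ∑ k ∈ d.divisors,
          ((k.divisors.card : ℝ)) ^ 2 *
            (|A.remainder d (min ((k : ℝ) * z) x)| + |A.remainder d (min ((k : ℝ) * (s * z)) x)|) := by
  classical
  set X := ⌊x⌋₊ with hX
  have hlogx : 0 ≤ Real.log x := Real.log_nonneg hx
  -- the bound for one `(k, d)`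
  set Bd : ℕ → ℕ → ℝ := fun k d =>
    ∑ n ∈ Icc 1 X, |A.remainder d n| / n +
      Real.log x * (|A.remainder d (min ((k : ℝ) * z) x)| + |A.remainder d (min ((k : ℝ) * (s * z)) x)|)
    with hBd
  have hBd0 : ∀ k d, 0 ≤ Bd k d := fun k d =>
    add_nonneg (Finset.sum_nonneg fun n _ => by positivity) (by positivity)
  set G : ℕ → ℕ → ℝ := fun k d =>
    if Squarefree d ∧ ((d * C₀ : ℕ) : ℝ) < x then ((k.divisors.card : ℝ)) ^ 2 * Bd k d else 0 with hG
  have hG0 : ∀ k d, 0 ≤ G k d := fun k d => by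
    rw [hG]; dsimp only; split_ifs
    · exact mul_nonneg (sq_nonneg _) (hBd0 k d)
    · exact le_rfl
  -- Step 1: termwise bound by `G k (kℓ)`
  have hterm : ∀ k ∈ Icc 1 X, ∀ ℓ ∈ Icc 1 (X / k),
      |(if Squarefree (k * ℓ) then Mf k * (sieveRho lam k : ℝ) * (μ ℓ : ℝ) *
          (∑ n ∈ (Icc 1 X).filter (fun n => k * ℓ ∣ n),
              (if (k : ℝ) * z < n ∧ (n : ℝ) ≤ k * (s * z) ∧ (n : ℝ) ≤ x then
                Real.posLog ((n : ℝ) / ((k * ℓ * C₀ : ℕ) : ℝ)) else 0) * A.a n -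
            A.density (k * ℓ) * ∑ n ∈ Icc 1 X,
              (if (k : ℝ) * z < n ∧ (n : ℝ) ≤ k * (s * z) ∧ (n : ℝ) ≤ x then
                Real.posLog ((n : ℝ) / ((k * ℓ * C₀ : ℕ) : ℝ)) else 0) * A.a n)
        else 0)| ≤ G k (k * ℓ) := by
    intro k hk ℓ hℓ
    have hk1 : 1 ≤ k := (Finset.mem_Icc.mp hk).1
    have hℓ1 : 1 ≤ ℓ := (Finset.mem_Icc.mp hℓ).1
    rw [hG]
    dsimp only
    split_ifs with hsq hcond
    · -- main case
      rw [abs_mul, abs_mul, abs_mul]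
      have h1 : |Mf k| ≤ (k.divisors.card : ℝ) := hMf k
      have h2 : |(sieveRho lam k : ℝ)| ≤ (k.divisors.card : ℝ) := by
        rw [abs_of_nonneg (by exact_mod_cast hw.sieveRho_nonneg k)]
        exact hw.sieveRho_le_card_divisors k
      have h3 : |(μ ℓ : ℝ)| ≤ 1 := by exact_mod_cast ArithmeticFunction.abs_moebius_le_one
      have hR1 : (1 : ℝ) ≤ ((k * ℓ * C₀ : ℕ) : ℝ) := by
        exact_mod_cast Nat.mul_pos (Nat.mul_pos hk1 hℓ1) hC
      have h4 := A.abs_smooth_remainder_le hsize (k * ℓ) ((k : ℝ) * (s * z)) hR1 hx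
        (show 0 ≤ (k : ℝ) * z by positivity)
      calc |Mf k| * |(sieveRho lam k : ℝ)| * |(μ ℓ : ℝ)| * _
          ≤ (k.divisors.card : ℝ) * (k.divisors.card : ℝ) * 1 * Bd k (k * ℓ) :=
            mul_le_mul (mul_le_mul (mul_le_mul h1 h2 (abs_nonneg _) (Nat.cast_nonneg _)) h3
              (abs_nonneg _) (by positivity)) h4 (abs_nonneg _) (by positivity)
        _ = ((k.divisors.card : ℝ)) ^ 2 * Bd k (k * ℓ) := by ring
    · -- `kℓ C₀ ≥ x`: everything vanishes
      push Not at hcond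
      have hcond' : x ≤ ((k * ℓ * C₀ : ℕ) : ℝ) := hcond hsq
      have hR0 : (0 : ℝ) < ((k * ℓ * C₀ : ℕ) : ℝ) := by
        exact_mod_cast Nat.mul_pos (Nat.mul_pos hk1 hℓ1) hC
      have hφ0 : ∀ n : ℕ, (if (k : ℝ) * z < n ∧ (n : ℝ) ≤ k * (s * z) ∧ (n : ℝ) ≤ x then
          Real.posLog ((n : ℝ) / ((k * ℓ * C₀ : ℕ) : ℝ)) else 0) = 0 := fun n =>
        phi_eq_zero_of_le hR0 hcond' n
      simp only [hφ0, zero_mul, Finset.sum_const_zero, mul_zero, sub_zero, abs_zero, le_refl]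
    · rw [abs_zero]; exact mul_nonneg (sq_nonneg _) (hBd0 _ _)
    · rw [abs_zero]
  -- Step 2: sum, reindex by `d = kℓ`, and restrict to `d ≤ Dn` squarefree
  refine (Finset.abs_sum_le_sum_abs _ _).trans ?_
  refine (Finset.sum_le_sum fun k hk => (Finset.abs_sum_le_sum_abs _ _).trans
    (Finset.sum_le_sum fun ℓ hℓ => hterm k hk ℓ hℓ)).trans ?_
  rw [sum_Icc_sum_Icc_div_eq_sum_sum_divisors G X]
  -- `∑_{d ≤ X} ∑_{k ∣ d} G k d ≤ ∑_{d ≤ Dn sqf} ∑_{k ∣ d} τ(k)² Bd k d`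
  have hstep : ∑ d ∈ Icc 1 X, ∑ k ∈ d.divisors, G k d ≤
      ∑ d ∈ (Icc 1 Dn).filter Squarefree, ∑ k ∈ d.divisors, ((k.divisors.card : ℝ)) ^ 2 * Bd k d := by
    have h1 : ∑ d ∈ Icc 1 X, ∑ k ∈ d.divisors, G k d =
        ∑ d ∈ (Icc 1 X).filter (fun d => Squarefree d ∧ ((d * C₀ : ℕ) : ℝ) < x),
          ∑ k ∈ d.divisors, ((k.divisors.card : ℝ)) ^ 2 * Bd k d := by
      rw [Finset.sum_filter]
      refine Finset.sum_congr rfl fun d _ => ?_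
      split_ifs with h
      · refine Finset.sum_congr rfl fun k _ => ?_
        rw [hG]; dsimp only; rw [if_pos h]
      · refine Finset.sum_eq_zero fun k _ => ?_
        rw [hG]; dsimp only; rw [if_neg h]
    rw [h1]
    refine Finset.sum_le_sum_of_subset_of_nonneg (fun d hd => ?_) fun d _ _ =>
      Finset.sum_nonneg fun k _ => mul_nonneg (sq_nonneg _) (hBd0 k d)
    obtain ⟨hd1, hsq, hlt⟩ := Finset.mem_filter.mp hd
    exact Finset.mem_filter.mpr ⟨Finset.mem_Icc.mpr ⟨(Finset.mem_Icc.mp hd1).1, hD d hlt⟩, hsq⟩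
  refine hstep.trans (le_of_eq ?_)
  -- Step 3: split `Bd` into its two parts
  rw [Finset.mul_sum, ← Finset.sum_add_distrib]
  refine Finset.sum_congr rfl fun d hd => ?_
  have hdsq := (Finset.mem_filter.mp hd).2
  rw [← sum_divisors_card_divisors_sq hdsq, Finset.sum_mul, Finset.mul_sum, ← Finset.sum_add_distrib]
  refine Finset.sum_congr rfl fun k _ => ?_
  rw [hBd]
  ring

end SieveSequence

/-! ### The main terms `S*(x; y, z)`: cancellation in `b` via (2.4) -/

/-- **Abel summation against a nonnegative nonincreasing weight**: if all partial sums
`∑_{A₁ < b ≤ M} c_b` (`A₁ ≤ M ≤ A₂`) are at most `P` in absolute value, then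
`|∑_{A₁ < b ≤ A₂} c_b w_b| ≤ P w_{A₁+1}`. [folklore] -/
theorem abs_sum_Ioc_mul_le_of_antitone (c w : ℕ → ℝ) {A₁ A₂ : ℕ} (hA : A₁ ≤ A₂) {P : ℝ}
    (hw0 : ∀ b, A₁ < b → 0 ≤ w b) (hanti : ∀ b, A₁ < b → w (b + 1) ≤ w b)
    (hP : ∀ M, A₁ ≤ M → M ≤ A₂ → |∑ b ∈ Ioc A₁ M, c b| ≤ P) :
    |∑ b ∈ Ioc A₁ A₂, c b * w b| ≤ P * w (A₁ + 1) := by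
  have hP0 : 0 ≤ P := le_trans (abs_nonneg _) (hP A₁ le_rfl hA)
  -- invariant
  have key : ∀ M, A₁ ≤ M → M ≤ A₂ →
      |∑ b ∈ Ioc A₁ M, c b * w b - (∑ b ∈ Ioc A₁ M, c b) * w (M + 1)| ≤
        P * (w (A₁ + 1) - w (M + 1)) := by
    intro M hM
    induction M, hM using Nat.le_induction with
    | base => intro _; simp
    | succ M hM ih =>
      intro hM2
      have ih' := ih (by omega)
      rw [Finset.sum_Ioc_succ_top hM, Finset.sum_Ioc_succ_top hM]
      have hS := hP (M + 1) (by omega) hM2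
      rw [Finset.sum_Ioc_succ_top hM] at hS
      have hdw : 0 ≤ w (M + 1) - w (M + 1 + 1) := by linarith [hanti (M + 1) (by omega)]
      have hid : ∑ b ∈ Ioc A₁ M, c b * w b + c (M + 1) * w (M + 1) -
          (∑ b ∈ Ioc A₁ M, c b + c (M + 1)) * w (M + 1 + 1) =
          (∑ b ∈ Ioc A₁ M, c b * w b - (∑ b ∈ Ioc A₁ M, c b) * w (M + 1)) +
            (∑ b ∈ Ioc A₁ M, c b + c (M + 1)) * (w (M + 1) - w (M + 1 + 1)) := by ring
      rw [hid]
      calc |(∑ b ∈ Ioc A₁ M, c b * w b - (∑ b ∈ Ioc A₁ M, c b) * w (M + 1)) +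
            (∑ b ∈ Ioc A₁ M, c b + c (M + 1)) * (w (M + 1) - w (M + 1 + 1))|
          ≤ |∑ b ∈ Ioc A₁ M, c b * w b - (∑ b ∈ Ioc A₁ M, c b) * w (M + 1)| +
            |(∑ b ∈ Ioc A₁ M, c b + c (M + 1)) * (w (M + 1) - w (M + 1 + 1))| := abs_add_le _ _
        _ ≤ P * (w (A₁ + 1) - w (M + 1)) + P * (w (M + 1) - w (M + 1 + 1)) := by
            refine add_le_add ih' ?_
            rw [abs_mul, abs_of_nonneg hdw]
            exact mul_le_mul_of_nonneg_right hS hdw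
        _ = P * (w (A₁ + 1) - w (M + 1 + 1)) := by ring
  have h1 := key A₂ hA le_rfl
  have h2 := hP A₂ hA le_rfl
  have hw2 := hw0 (A₂ + 1) (by omega)
  calc |∑ b ∈ Ioc A₁ A₂, c b * w b|
      = |(∑ b ∈ Ioc A₁ A₂, c b * w b - (∑ b ∈ Ioc A₁ A₂, c b) * w (A₂ + 1)) +
          (∑ b ∈ Ioc A₁ A₂, c b) * w (A₂ + 1)| := by ring_nf
    _ ≤ |∑ b ∈ Ioc A₁ A₂, c b * w b - (∑ b ∈ Ioc A₁ A₂, c b) * w (A₂ + 1)| +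
          |(∑ b ∈ Ioc A₁ A₂, c b) * w (A₂ + 1)| := abs_add_le _ _
    _ ≤ P * (w (A₁ + 1) - w (A₂ + 1)) + P * w (A₂ + 1) := by
        refine add_le_add h1 ?_
        rw [abs_mul, abs_of_nonneg hw2]
        exact mul_le_mul_of_nonneg_right h2 hw2
    _ = P * w (A₁ + 1) := by ring

/-- A nonempty "upper" subset of `Icc 1 N` is a final segment `Ioc A₁ N`, `A₁ = min - 1`. [folklore] -/
theorem eq_Ioc_of_upper {S : Finset ℕ} {N : ℕ} (hS : S ⊆ Icc 1 N) (hne : S.Nonempty)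
    (hup : ∀ b ∈ S, ∀ b', b ≤ b' → b' ≤ N → b' ∈ S) :
    S = Ioc (S.min' hne - 1) N := by
  ext b
  have hmin := Finset.min'_mem S hne
  have hmin1 : 1 ≤ S.min' hne := (Finset.mem_Icc.mp (hS hmin)).1
  constructor
  · intro hb
    have h1 := Finset.min'_le S b hb
    have h2 := (Finset.mem_Icc.mp (hS hb)).2
    exact Finset.mem_Ioc.mpr ⟨by omega, h2⟩
  · intro hb
    obtain ⟨h1, h2⟩ := Finset.mem_Ioc.mp hb
    exact hup _ hmin b (by omega) h2

/-- **(2.4) on a segment** (FI §8: "`∑_{(b, eℓν₁)=1, b_min < bν₁ < b_max} μ(b)g(b)` and here, by (2.4),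
the inner sum is `O(σ_{eℓν₁}(log x)^{-6})`"): for `q ≥ 1` and `2 ≤ A₁ ≤ M`,
`|∑_{A₁ < b ≤ M, (b,q)=1} μ(b)g(b)| ≤ 2|K|σ_q/(log A₁)⁶`. [cite: FriedlanderIwaniecASP1998, §8 (8.3)] -/
theorem abs_sum_Ioc_coprime_moebius_density_le {g : ArithmeticFunction ℝ} {K : ℝ}
    (h24 : ∀ ν : ℕ, 1 ≤ ν → ∀ y : ℝ, 2 ≤ y →
      |∑ d ∈ (Icc 1 ⌊y⌋₊).filter (fun d : ℕ => d.Coprime ν), (μ d : ℝ) * g d| ≤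
        K * sigmaHalf ν / Real.log y ^ 6)
    {q : ℕ} (hq : 1 ≤ q) {A₁ M : ℕ} (hA : 2 ≤ A₁) (hAM : A₁ ≤ M) :
    |∑ b ∈ Ioc A₁ M, (if b.Coprime q then (μ b : ℝ) * g b else 0)| ≤
      2 * |K| * sigmaHalf q / Real.log A₁ ^ 6 := by
  classical
  have hG : ∀ N : ℕ, 2 ≤ N → |∑ b ∈ (Icc 1 N).filter (fun d : ℕ => d.Coprime q), (μ b : ℝ) * g b| ≤
      |K| * sigmaHalf q / Real.log N ^ 6 := by
    intro N hN
    have h := h24 q hq N (by exact_mod_cast hN)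
    rw [Nat.floor_natCast] at h
    refine h.trans ?_
    exact div_le_div_of_nonneg_right (mul_le_mul_of_nonneg_right (le_abs_self K)
      (le_trans zero_le_one (one_le_sigmaHalf q))) (by positivity)
  have hsplit : ∑ b ∈ Ioc A₁ M, (if b.Coprime q then (μ b : ℝ) * g b else 0) =
      ∑ b ∈ (Icc 1 M).filter (fun d : ℕ => d.Coprime q), (μ b : ℝ) * g b -
        ∑ b ∈ (Icc 1 A₁).filter (fun d : ℕ => d.Coprime q), (μ b : ℝ) * g b := by
    rw [Finset.sum_filter, Finset.sum_filter]
    have hsub : Icc 1 A₁ ⊆ Icc 1 M := Finset.Icc_subset_Icc_right hAM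
    rw [← Finset.sum_sdiff hsub, add_sub_cancel_right]
    congr 1
    ext b
    simp only [Finset.mem_sdiff, Finset.mem_Icc, Finset.mem_Ioc]
    omega
  rw [hsplit]
  have hA0 : (1 : ℝ) < A₁ := by exact_mod_cast (show 1 < A₁ by omega)
  have hlogA : 0 < Real.log A₁ := Real.log_pos hA0
  have hlogM : Real.log A₁ ≤ Real.log M := Real.log_le_log (by linarith) (by exact_mod_cast hAM)
  have hσ : 0 ≤ |K| * sigmaHalf q := mul_nonneg (abs_nonneg _) (le_trans zero_le_one (one_le_sigmaHalf q))
  calc |∑ b ∈ (Icc 1 M).filter (fun d : ℕ => d.Coprime q), (μ b : ℝ) * g b -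
        ∑ b ∈ (Icc 1 A₁).filter (fun d : ℕ => d.Coprime q), (μ b : ℝ) * g b|
      ≤ |K| * sigmaHalf q / Real.log M ^ 6 + |K| * sigmaHalf q / Real.log A₁ ^ 6 :=
        (abs_sub _ _).trans (add_le_add (hG M (hA.trans hAM)) (hG A₁ hA))
    _ ≤ |K| * sigmaHalf q / Real.log A₁ ^ 6 + |K| * sigmaHalf q / Real.log A₁ ^ 6 := by
        refine add_le_add ?_ le_rfl
        exact div_le_div_of_nonneg_left hσ (by positivity) (pow_le_pow_left₀ hlogA.le hlogM 6)
    _ = 2 * |K| * sigmaHalf q / Real.log A₁ ^ 6 := by ring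

/-- **The `b`-sum of the main term** (FI §8: "We get a significant cancellation from summation of
`μ(b)`. Note that `b` ranges over the interval `b_min < b < b_max` where `b_min = max{sy, n/esz}` and
`b_max = min{n/ez, n/eℓt}`", discrete form with the smooth weight): for `1 ≤ n ≤ x`, reals
`u ≥ 0` (`= sy/ν`), `α, β, γ > 0` (`= eνz`, `eνsz`, `eνℓC₀`), `q ≥ 1`, and `⌊u⌋ ≥ 2`:
`|∑_{b ≤ N} [(b,q)=1]μ(b)g(b) · [u < b, αb < n ≤ βb] log⁺(n/(γb))| ≤ 2|K|σ_q (log ⌊u⌋)^{-6} · log x`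
(the conditions `u < b`, `n ≤ βb` cut out a final segment of `[1, N]`, on which the weight
`[αb < n] log⁺(n/(γb))` is nonnegative and nonincreasing; Abel summation and (2.4) at the two ends).
[cite: FriedlanderIwaniecASP1998, §8 (8.3)] -/
theorem abs_sum_bprime_le {g : ArithmeticFunction ℝ} {K : ℝ}
    (h24 : ∀ ν : ℕ, 1 ≤ ν → ∀ y : ℝ, 2 ≤ y →
      |∑ d ∈ (Icc 1 ⌊y⌋₊).filter (fun d : ℕ => d.Coprime ν), (μ d : ℝ) * g d| ≤
        K * sigmaHalf ν / Real.log y ^ 6)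
    {q : ℕ} (hq : 1 ≤ q) {x : ℝ} (hx : 1 ≤ x) {n : ℕ} (hnx : (n : ℝ) ≤ x)
    {u α β γ : ℝ} (hu : 0 ≤ u) (hα : 0 < α) (hγ : 1 ≤ γ) (hu2 : 2 ≤ ⌊u⌋₊) (N : ℕ) :
    |∑ b ∈ Icc 1 N, (if b.Coprime q then (μ b : ℝ) * g b else 0) *
        (if u < (b : ℝ) ∧ α * b < n ∧ (n : ℝ) ≤ β * b ∧ (n : ℝ) ≤ x then
          Real.posLog ((n : ℝ) / (γ * b)) else 0)| ≤
      2 * |K| * sigmaHalf q / Real.log (⌊u⌋₊ : ℝ) ^ 6 * Real.log x := by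
  classical
  set c : ℕ → ℝ := fun b => if b.Coprime q then (μ b : ℝ) * g b else 0 with hc
  set f : ℕ → ℝ := fun b => if α * b < n ∧ (n : ℝ) ≤ x then Real.posLog ((n : ℝ) / (γ * b)) else 0
    with hf
  set T := (Icc 1 N).filter (fun b : ℕ => u < (b : ℝ) ∧ (n : ℝ) ≤ β * b) with hT
  have hlogx : 0 ≤ Real.log x := Real.log_nonneg hx
  have hRHS0 : 0 ≤ 2 * |K| * sigmaHalf q / Real.log (⌊u⌋₊ : ℝ) ^ 6 * Real.log x := by
    have := one_le_sigmaHalf q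
    positivity
  -- rewrite the sum as a sum over `T` of `c b * f b`
  have h1 : ∑ b ∈ Icc 1 N, c b *
      (if u < (b : ℝ) ∧ α * b < n ∧ (n : ℝ) ≤ β * b ∧ (n : ℝ) ≤ x then
        Real.posLog ((n : ℝ) / (γ * b)) else 0) = ∑ b ∈ T, c b * f b := by
    rw [hT, Finset.sum_filter]
    refine Finset.sum_congr rfl fun b _ => ?_
    by_cases hTb : u < (b : ℝ) ∧ (n : ℝ) ≤ β * b
    · rw [if_pos hTb, hf]
      dsimp only
      by_cases hfb : α * b < n ∧ (n : ℝ) ≤ x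
      · rw [if_pos ⟨hTb.1, hfb.1, hTb.2, hfb.2⟩, if_pos hfb]
      · rw [if_neg (fun h => hfb ⟨h.2.1, h.2.2.2⟩), if_neg hfb]
    · rw [if_neg hTb, if_neg (fun h => hTb ⟨h.1, h.2.2.1⟩), mul_zero]
  rw [h1]
  rcases T.eq_empty_or_nonempty with hTe | hTne
  · rw [hTe, Finset.sum_empty, abs_zero]; exact hRHS0
  -- `T` is a final segment `Ioc A₁ N`
  have hTsub : T ⊆ Icc 1 N := Finset.filter_subset _ _
  have hup : ∀ b ∈ T, ∀ b', b ≤ b' → b' ≤ N → b' ∈ T := by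
    intro b hb b' hbb' hb'N
    obtain ⟨hb1, hub, hnb⟩ := Finset.mem_filter.mp hb
    have hb1' := (Finset.mem_Icc.mp hb1).1
    have hcast : (b : ℝ) ≤ b' := by exact_mod_cast hbb'
    refine Finset.mem_filter.mpr ⟨Finset.mem_Icc.mpr ⟨by omega, hb'N⟩, lt_of_lt_of_le hub hcast, ?_⟩
    have hβ : 0 ≤ β := by
      by_contra hβ
      push Not at hβ
      have : β * b < 0 := mul_neg_of_neg_of_pos hβ (by exact_mod_cast hb1')
      have hn0 : (0 : ℝ) ≤ n := Nat.cast_nonneg n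
      linarith
    exact hnb.trans (mul_le_mul_of_nonneg_left hcast hβ)
  set A₁ := T.min' hTne - 1 with hA₁
  have hTeq : T = Ioc A₁ N := eq_Ioc_of_upper hTsub hTne hup
  -- `A₁ ≥ ⌊u⌋`
  have hminT := Finset.min'_mem T hTne
  have hmin1 : 1 ≤ T.min' hTne := (Finset.mem_Icc.mp (hTsub hminT)).1
  have hA₁u : ⌊u⌋₊ ≤ A₁ := by
    have hum : u < (T.min' hTne : ℝ) := (Finset.mem_filter.mp hminT).2.1
    have : ⌊u⌋₊ < T.min' hTne := (Nat.floor_lt hu).mpr hum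
    omega
  have hA₁2 : 2 ≤ A₁ := hu2.trans hA₁u
  have hA₁N : A₁ ≤ N := by
    have := (Finset.mem_Icc.mp (hTsub hminT)).2; omega
  rw [hTeq]
  -- Abel summation
  have hf0 : ∀ b, 0 ≤ f b := fun b => by
    rw [hf]; dsimp only; split_ifs
    · exact Real.posLog_nonneg
    · exact le_rfl
  have hanti : ∀ b, A₁ < b → f (b + 1) ≤ f b := by
    intro b hb
    rw [hf]; dsimp only
    by_cases h1 : α * ((b + 1 : ℕ) : ℝ) < n ∧ (n : ℝ) ≤ x
    · have h0 : α * (b : ℝ) < n ∧ (n : ℝ) ≤ x := by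
        refine ⟨lt_of_le_of_lt ?_ h1.1, h1.2⟩
        exact mul_le_mul_of_nonneg_left (by push_cast; linarith) hα.le
      rw [if_pos h1, if_pos h0]
      have hb0 : (0 : ℝ) < b := by exact_mod_cast (show 0 < b by omega)
      refine Real.monotoneOn_posLog (show (0 : ℝ) ≤ _ by positivity)
        (show (0 : ℝ) ≤ _ by positivity) ?_
      exact div_le_div_of_nonneg_left (Nat.cast_nonneg n) (by positivity)
        (mul_le_mul_of_nonneg_left (by push_cast; linarith) (by linarith))
    · rw [if_neg h1]; exact hf0 b
  have hP : ∀ M, A₁ ≤ M → M ≤ N → |∑ b ∈ Ioc A₁ M, c b| ≤ 2 * |K| * sigmaHalf q / Real.log A₁ ^ 6 :=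
    fun M hM _ => abs_sum_Ioc_coprime_moebius_density_le h24 hq hA₁2 hM
  refine (abs_sum_Ioc_mul_le_of_antitone c f hA₁N (fun b _ => hf0 b) hanti hP).trans ?_
  -- `f (A₁+1) ≤ log x` and `log A₁ ≥ log ⌊u⌋`
  have hfle : f (A₁ + 1) ≤ Real.log x := by
    rw [hf]; dsimp only
    split_ifs with h
    · refine posLog_le_log (by positivity) ?_ hx
      have h1 : (1 : ℝ) ≤ γ * ((A₁ + 1 : ℕ) : ℝ) := by
        have : (1 : ℝ) ≤ ((A₁ + 1 : ℕ) : ℝ) := by exact_mod_cast Nat.succ_le_succ (Nat.zero_le _)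
        nlinarith
      exact (div_le_self (Nat.cast_nonneg n) h1).trans hnx
    · exact hlogx
  have hu2' : (2 : ℝ) ≤ ⌊u⌋₊ := by exact_mod_cast hu2
  have hlogu : 0 < Real.log (⌊u⌋₊ : ℝ) := Real.log_pos (by linarith)
  have hlogA : Real.log (⌊u⌋₊ : ℝ) ≤ Real.log A₁ :=
    Real.log_le_log (by linarith) (by exact_mod_cast hA₁u)
  have hσ0 : 0 ≤ 2 * |K| * sigmaHalf q := by
    have := one_le_sigmaHalf q; positivity
  calc 2 * |K| * sigmaHalf q / Real.log A₁ ^ 6 * f (A₁ + 1)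
      ≤ 2 * |K| * sigmaHalf q / Real.log (⌊u⌋₊ : ℝ) ^ 6 * Real.log x := by
        refine mul_le_mul ?_ hfle (hf0 _) (by positivity)
        exact div_le_div_of_nonneg_left hσ0 (by positivity) (pow_le_pow_left₀ hlogu.le hlogA 6)

/-- **Pointwise form of the `b`-summand after `b = ν₂ b'`** (FI §8: "`∑_{(b,eℓ)=1} μ(b)ρ_{eb} g(ebℓ)
= g(eℓ) ∑_{ν₁} μ(ν₁)g(ν₁) ∑_{ν₂∣e} λ_{ν₁ν₂} ∑_{(b, eℓν₁)=1} μ(b)g(b)`", one term): for `ν₂, e, ℓ ≥ 1`,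
`z`, and the cutoff `μ(b > sy)`,
`μ(b'ν₂ > sy) [b'ν₂eℓ sqfree] g(b'ν₂) φ_{b'ν₂e,ℓ}(n)
  = (μ(ν₂) g(ν₂) [ν₂eℓ sqfree]) · ([(b', ν₂eℓ)=1] μ(b')g(b')) · ω(b')`
with `ω(b') = [sy/ν₂ < b', (ν₂ez)b' < n ≤ (ν₂esz)b', n ≤ x] log⁺(n/((ν₂eℓC₀)b'))`.
[cite: FriedlanderIwaniecASP1998, §8 (8.3)] -/
theorem bprime_summand_eq {g : ArithmeticFunction ℝ} (hg : g.IsMultiplicative) {ν₂ e ℓ C₀ : ℕ}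
    (hν : 1 ≤ ν₂) (x y z s : ℝ) (n b' : ℕ) :
    truncGT (μ : ArithmeticFunction ℝ) (s * y) (b' * ν₂) *
        ((if Squarefree (b' * ν₂ * e * ℓ) then g (b' * ν₂) else 0) *
          (if (((b' * ν₂ * e : ℕ)) : ℝ) * z < n ∧ (n : ℝ) ≤ ((b' * ν₂ * e : ℕ) : ℝ) * (s * z) ∧
              (n : ℝ) ≤ x then
            Real.posLog ((n : ℝ) / ((b' * ν₂ * e * ℓ * C₀ : ℕ) : ℝ)) else 0)) =
      ((μ ν₂ : ℝ) * g ν₂ * (if Squarefree (ν₂ * e * ℓ) then 1 else 0)) *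
        (if b'.Coprime (ν₂ * e * ℓ) then (μ b' : ℝ) * g b' else 0) *
        (if s * y / ν₂ < (b' : ℝ) ∧ ((ν₂ * e : ℕ) : ℝ) * z * b' < n ∧
            (n : ℝ) ≤ ((ν₂ * e : ℕ) : ℝ) * (s * z) * b' ∧ (n : ℝ) ≤ x then
          Real.posLog ((n : ℝ) / (((ν₂ * e * ℓ * C₀ : ℕ) : ℝ) * b')) else 0) := by
  have hν0 : (0 : ℝ) < ν₂ := by exact_mod_cast hν
  -- the two cutoff conditions agree
  have hcond : ((((b' * ν₂ * e : ℕ)) : ℝ) * z < n ∧ (n : ℝ) ≤ ((b' * ν₂ * e : ℕ) : ℝ) * (s * z) ∧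
      (n : ℝ) ≤ x) ↔ (((ν₂ * e : ℕ) : ℝ) * z * b' < n ∧
        (n : ℝ) ≤ ((ν₂ * e : ℕ) : ℝ) * (s * z) * b' ∧ (n : ℝ) ≤ x) := by
    have h1 : (((b' * ν₂ * e : ℕ)) : ℝ) * z = ((ν₂ * e : ℕ) : ℝ) * z * b' := by push_cast; ring
    have h2 : ((b' * ν₂ * e : ℕ) : ℝ) * (s * z) = ((ν₂ * e : ℕ) : ℝ) * (s * z) * b' := by
      push_cast; ring
    rw [h1, h2]
  have hpl : Real.posLog ((n : ℝ) / ((b' * ν₂ * e * ℓ * C₀ : ℕ) : ℝ)) =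
      Real.posLog ((n : ℝ) / (((ν₂ * e * ℓ * C₀ : ℕ) : ℝ) * b')) := by
    congr 1; push_cast; ring
  have htrunc : truncGT (μ : ArithmeticFunction ℝ) (s * y) (b' * ν₂) =
      if s * y / ν₂ < (b' : ℝ) then (μ (b' * ν₂) : ℝ) else 0 := by
    rw [truncGT_apply, ArithmeticFunction.intCoe_apply]
    have : (s * y < ((b' * ν₂ : ℕ) : ℝ)) ↔ (s * y / ν₂ < (b' : ℝ)) := by
      rw [div_lt_iff₀ hν0]; push_cast; exact Iff.rfl
    simp only [this]
  rw [htrunc, hpl]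
  by_cases hsq : Squarefree (b' * ν₂ * e * ℓ)
  · have hsq' : Squarefree (b' * (ν₂ * e * ℓ)) := by
      have : b' * ν₂ * e * ℓ = b' * (ν₂ * e * ℓ) := by ring
      rwa [this] at hsq
    have hcop : b'.Coprime (ν₂ * e * ℓ) := Nat.coprime_of_squarefree_mul hsq'
    have hq : Squarefree (ν₂ * e * ℓ) := Squarefree.of_mul_right hsq'
    have hbν : Squarefree (b' * ν₂) := Squarefree.of_mul_left (Squarefree.of_mul_left hsq)
    have hcop' : b'.Coprime ν₂ := Nat.coprime_of_squarefree_mul hbν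
    rw [if_pos hsq, if_pos hq, if_pos hcop,
      ArithmeticFunction.isMultiplicative_moebius.map_mul_of_coprime hcop', Int.cast_mul,
      hg.map_mul_of_coprime hcop']
    by_cases h1 : s * y / ν₂ < (b' : ℝ)
    · rw [if_pos h1]
      by_cases h2 : ((ν₂ * e : ℕ) : ℝ) * z * b' < n ∧
          (n : ℝ) ≤ ((ν₂ * e : ℕ) : ℝ) * (s * z) * b' ∧ (n : ℝ) ≤ x
      · rw [if_pos (hcond.mpr h2),
          if_pos (show s * y / ν₂ < (b' : ℝ) ∧ (((ν₂ * e : ℕ) : ℝ) * z * b' < n ∧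
            (n : ℝ) ≤ ((ν₂ * e : ℕ) : ℝ) * (s * z) * b' ∧ (n : ℝ) ≤ x) from ⟨h1, h2⟩)]
        ring
      · rw [if_neg (show ¬((((b' * ν₂ * e : ℕ)) : ℝ) * z < n ∧
            (n : ℝ) ≤ ((b' * ν₂ * e : ℕ) : ℝ) * (s * z) ∧ (n : ℝ) ≤ x) from fun h => h2 (hcond.mp h)),
          if_neg (show ¬(s * y / ν₂ < (b' : ℝ) ∧ (((ν₂ * e : ℕ) : ℝ) * z * b' < n ∧
            (n : ℝ) ≤ ((ν₂ * e : ℕ) : ℝ) * (s * z) * b' ∧ (n : ℝ) ≤ x)) from fun h => h2 h.2)]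
        ring
    · rw [if_neg h1,
        if_neg (show ¬(s * y / ν₂ < (b' : ℝ) ∧ (((ν₂ * e : ℕ) : ℝ) * z * b' < n ∧
          (n : ℝ) ≤ ((ν₂ * e : ℕ) : ℝ) * (s * z) * b' ∧ (n : ℝ) ≤ x)) from fun h => h1 h.1)]
      ring
  · rw [if_neg hsq, zero_mul, mul_zero]
    -- the right side vanishes too
    by_cases hcop : b'.Coprime (ν₂ * e * ℓ)
    · rw [if_pos hcop]
      have : ¬(Squarefree b' ∧ Squarefree (ν₂ * e * ℓ)) := by
        rintro ⟨h1, h2⟩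
        apply hsq
        have : b' * ν₂ * e * ℓ = b' * (ν₂ * e * ℓ) := by ring
        rw [this, Nat.squarefree_mul_iff]
        exact ⟨hcop, h1, h2⟩
      by_cases hb : Squarefree b'
      · have hq : ¬Squarefree (ν₂ * e * ℓ) := fun h => this ⟨hb, h⟩
        rw [if_neg hq]; ring
      · rw [ArithmeticFunction.moebius_eq_zero_of_not_squarefree hb]; simp
    · rw [if_neg hcop]; ring

/-- **The `b'`-sum of the main term, bounded** (one pair `ν₁, ν₂`): under the hypotheses of
`abs_sum_bprime_le` (with `u = sy/ν₂`, `⌊u⌋ ≥ 2`), for `ν₂, e, ℓ, C₀ ≥ 1`, `z > 0`, `1 ≤ n ≤ x`,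
`|∑_{b' ≤ N} μ(b'ν₂ > sy)[b'ν₂eℓ sqfree] g(b'ν₂) φ(n)| ≤ [ν₂ sqfree] g(ν₂) · 2|K|σ_{ν₂eℓ}(log⌊sy/ν₂⌋)^{-6} log x`.
[cite: FriedlanderIwaniecASP1998, §8 (8.3)] -/
theorem abs_sum_bprime_nu_le {g : ArithmeticFunction ℝ} (hg : g.IsMultiplicative)
    (hg0 : ∀ p : ℕ, p.Prime → 0 ≤ g p) {K : ℝ}
    (h24 : ∀ ν : ℕ, 1 ≤ ν → ∀ y : ℝ, 2 ≤ y →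
      |∑ d ∈ (Icc 1 ⌊y⌋₊).filter (fun d : ℕ => d.Coprime ν), (μ d : ℝ) * g d| ≤
        K * sigmaHalf ν / Real.log y ^ 6)
    {ν₂ e ℓ C₀ : ℕ} (hν : 1 ≤ ν₂) (he : 1 ≤ e) (hℓ : 1 ≤ ℓ) (hC : 1 ≤ C₀)
    {x y z s : ℝ} (hx : 1 ≤ x) (hz : 0 < z) (hsy : 0 ≤ s * y) (hu2 : 2 ≤ ⌊s * y / ν₂⌋₊)
    {n : ℕ} (hnx : (n : ℝ) ≤ x) (N : ℕ) :
    |∑ b' ∈ Icc 1 N, truncGT (μ : ArithmeticFunction ℝ) (s * y) (b' * ν₂) *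
        ((if Squarefree (b' * ν₂ * e * ℓ) then g (b' * ν₂) else 0) *
          (if (((b' * ν₂ * e : ℕ)) : ℝ) * z < n ∧ (n : ℝ) ≤ ((b' * ν₂ * e : ℕ) : ℝ) * (s * z) ∧
              (n : ℝ) ≤ x then
            Real.posLog ((n : ℝ) / ((b' * ν₂ * e * ℓ * C₀ : ℕ) : ℝ)) else 0))| ≤
      (if Squarefree ν₂ then g ν₂ else 0) *
        (2 * |K| * sigmaHalf (ν₂ * e * ℓ) / Real.log (⌊s * y / ν₂⌋₊ : ℝ) ^ 6 * Real.log x) := by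
  rw [Finset.sum_congr rfl fun b' _ => bprime_summand_eq hg hν x y z s n b' (e := e) (ℓ := ℓ)
    (C₀ := C₀)]
  simp_rw [mul_assoc ((μ ν₂ : ℝ) * g ν₂ * (if Squarefree (ν₂ * e * ℓ) then (1 : ℝ) else 0))]
  rw [← Finset.mul_sum, abs_mul]
  have hq : 1 ≤ ν₂ * e * ℓ := Nat.mul_pos (Nat.mul_pos hν he) hℓ
  have hα : (0 : ℝ) < ((ν₂ * e : ℕ) : ℝ) * z := by positivity
  have hγ : (1 : ℝ) ≤ ((ν₂ * e * ℓ * C₀ : ℕ) : ℝ) := by exact_mod_cast Nat.mul_pos hq hC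
  have hu : 0 ≤ s * y / ν₂ := by positivity
  have hmain := abs_sum_bprime_le h24 hq hx hnx hu hα hγ hu2 N
    (β := ((ν₂ * e : ℕ) : ℝ) * (s * z)) (g := g)
  have hRHS0 : 0 ≤ 2 * |K| * sigmaHalf (ν₂ * e * ℓ) / Real.log (⌊s * y / ν₂⌋₊ : ℝ) ^ 6 * Real.log x := by
    have := one_le_sigmaHalf (ν₂ * e * ℓ)
    have := Real.log_nonneg hx
    positivity
  refine (mul_le_mul_of_nonneg_left hmain (abs_nonneg _)).trans (mul_le_mul_of_nonneg_right ?_ hRHS0)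
  -- `|μ(ν₂) g(ν₂) [..]| ≤ [ν₂ sqfree] g(ν₂)`
  by_cases hν₂ : Squarefree ν₂
  · rw [if_pos hν₂, abs_mul, abs_mul]
    have h1 : |(μ ν₂ : ℝ)| ≤ 1 := by exact_mod_cast ArithmeticFunction.abs_moebius_le_one
    have h2 : |g ν₂| = g ν₂ := abs_of_nonneg (ArithmeticFunction.IsMultiplicative.nonneg_of_squarefree hg hg0 hν₂)
    have h3 : |(if Squarefree (ν₂ * e * ℓ) then (1 : ℝ) else 0)| ≤ 1 := by split_ifs <;> simp
    rw [h2]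
    calc |(μ ν₂ : ℝ)| * g ν₂ * |(if Squarefree (ν₂ * e * ℓ) then (1 : ℝ) else 0)|
        ≤ 1 * g ν₂ * 1 := by
          refine mul_le_mul (mul_le_mul_of_nonneg_right h1 (by rw [← h2]; exact abs_nonneg _)) h3
            (abs_nonneg _) (by rw [← h2]; positivity)
      _ = g ν₂ := by ring
  · rw [if_neg hν₂, ArithmeticFunction.moebius_eq_zero_of_not_squarefree hν₂]
    simp

/-- Swapping `∑_{b ≤ N} F(b) ∑_{ν ∣ b} G(ν) = ∑_{ν ≤ N} ∑_{b' ≤ N/ν} F(b'ν) G(ν)`. [folklore] -/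
theorem sum_Icc_mul_sum_divisors_eq (F : ℕ → ℝ) (G : ℕ → ℝ) (N : ℕ) :
    ∑ b ∈ Icc 1 N, F b * ∑ ν ∈ b.divisors, G ν =
      ∑ ν ∈ Icc 1 N, ∑ b' ∈ Icc 1 (N / ν), F (b' * ν) * G ν := by
  rw [← sum_Icc_sum_divisorsAntidiagonal_eq (fun p : ℕ × ℕ => F (p.1 * p.2) * G p.2) N]
  refine Finset.sum_congr rfl fun b _ => ?_
  rw [Finset.mul_sum]
  have h : ∀ p ∈ b.divisorsAntidiagonal, F (p.1 * p.2) * G p.2 = F b * G p.2 := fun p hp => by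
    rw [(Nat.mem_divisorsAntidiagonal.mp hp).1]
  rw [Finset.sum_congr rfl h, Nat.sum_divisorsAntidiagonal' (fun _ d => F b * G d)]

/-- **The `b`-sum `B(n, e, ℓ)` of the main term, bounded** (FI §8, (8.3): "`∑_{(b,eℓ)=1} μ(b)ρ_{eb}
g(ebℓ) = g(eℓ) ∑_{ν₁} μ(ν₁)g(ν₁) ∑_{ν₂∣e} λ_{ν₁ν₂} ∑ μ(b)g(b)` and here, by (2.4), the inner sum is
`O(σ_{eℓν₁}(log x)^{-6})`. Summing over all the other variables trivially…"): for the cutoff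
`μ(b > sy)`, weights of level `L_w`, `a₀ ≥ 2` with `a₀ ≤ ⌊sy/ν⌋` for all `ν ≤ L_w`, `e, ℓ, C₀ ≥ 1`,
`z > 0`, `1 ≤ n ≤ x`, `N_b ≤ ⌊x⌋`:
`|B(n,e,ℓ)| ≤ [e sqf] g(e)τ(e)σ_e · [ℓ sqf] g(ℓ)σ_ℓ · 2|K| log x (log a₀)^{-6} · ∑^♭_{ν ≤ x} g(ν)σ_ν`.
[cite: FriedlanderIwaniecASP1998, §8 (8.3)] -/
theorem abs_Bsum_le {g : ArithmeticFunction ℝ} (hg : g.IsMultiplicative)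
    (hg0 : ∀ p : ℕ, p.Prime → 0 ≤ g p) {K : ℝ}
    (h24 : ∀ ν : ℕ, 1 ≤ ν → ∀ y : ℝ, 2 ≤ y →
      |∑ d ∈ (Icc 1 ⌊y⌋₊).filter (fun d : ℕ => d.Coprime ν), (μ d : ℝ) * g d| ≤
        K * sigmaHalf ν / Real.log y ^ 6)
    {P Lw : ℝ} {lam : ℕ → ℤ} (hw : IsUpperSieveWeights P Lw lam)
    {e ℓ C₀ : ℕ} (he : 1 ≤ e) (hℓ : 1 ≤ ℓ) (hC : 1 ≤ C₀)
    {x y z s : ℝ} (hx : 1 ≤ x) (hz : 0 < z) (hsy : 0 ≤ s * y)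
    {a₀ : ℕ} (ha₀ : 2 ≤ a₀) (ha₀le : ∀ ν : ℕ, 1 ≤ ν → (ν : ℝ) ≤ Lw → a₀ ≤ ⌊s * y / ν⌋₊)
    {n : ℕ} (hnx : (n : ℝ) ≤ x) {Nb : ℕ} (hNb : Nb ≤ ⌊x⌋₊) :
    |∑ b ∈ Icc 1 Nb, truncGT (μ : ArithmeticFunction ℝ) (s * y) b *
        (if Squarefree (b * e * ℓ) then (sieveRho lam (b * e) : ℝ) * (μ ℓ : ℝ) * g (b * e * ℓ) *
          (if (((b * e : ℕ)) : ℝ) * z < n ∧ (n : ℝ) ≤ ((b * e : ℕ) : ℝ) * (s * z) ∧ (n : ℝ) ≤ x then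
            Real.posLog ((n : ℝ) / ((b * e * ℓ * C₀ : ℕ) : ℝ)) else 0) else 0)| ≤
      (if Squarefree e then g e * (e.divisors.card : ℝ) * sigmaHalf e else 0) *
        (if Squarefree ℓ then g ℓ * sigmaHalf ℓ else 0) *
        (2 * |K| * Real.log x / Real.log a₀ ^ 6) *
        ∑ ν ∈ (Icc 1 ⌊x⌋₊).filter Squarefree, g ν * sigmaHalf ν := by
  classical
  set X := ⌊x⌋₊ with hX
  set Cst := 2 * |K| * Real.log x / Real.log a₀ ^ 6 with hCst
  have hlogx : 0 ≤ Real.log x := Real.log_nonneg hx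
  have hCst0 : 0 ≤ Cst := by positivity
  set Sgs := ∑ ν ∈ (Icc 1 X).filter Squarefree, g ν * sigmaHalf ν with hSgs
  have hgsq0 : ∀ m : ℕ, Squarefree m → 0 ≤ g m := fun m hm =>
    ArithmeticFunction.IsMultiplicative.nonneg_of_squarefree hg hg0 hm
  have hSgs0 : 0 ≤ Sgs := Finset.sum_nonneg fun ν hν =>
    mul_nonneg (hgsq0 ν (Finset.mem_filter.mp hν).2) (le_trans zero_le_one (one_le_sigmaHalf ν))
  have hRHS0 : 0 ≤ (if Squarefree e then g e * (e.divisors.card : ℝ) * sigmaHalf e else 0) *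
      (if Squarefree ℓ then g ℓ * sigmaHalf ℓ else 0) * Cst * Sgs := by
    refine mul_nonneg (mul_nonneg (mul_nonneg ?_ ?_) hCst0) hSgs0
    · split_ifs with h
      · exact mul_nonneg (mul_nonneg (hgsq0 e h) (Nat.cast_nonneg _)) (le_trans zero_le_one (one_le_sigmaHalf e))
      · exact le_rfl
    · split_ifs with h
      · exact mul_nonneg (hgsq0 ℓ h) (le_trans zero_le_one (one_le_sigmaHalf ℓ))
      · exact le_rfl
  -- the cutoff and the `b'`-summand, abbreviated
  set φ : ℕ → ℝ := fun b =>
    if (((b * e : ℕ)) : ℝ) * z < n ∧ (n : ℝ) ≤ ((b * e : ℕ) : ℝ) * (s * z) ∧ (n : ℝ) ≤ x then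
      Real.posLog ((n : ℝ) / ((b * e * ℓ * C₀ : ℕ) : ℝ)) else 0 with hφ
  set F : ℕ → ℝ := fun b => truncGT (μ : ArithmeticFunction ℝ) (s * y) b *
    ((if Squarefree (b * e * ℓ) then g b else 0) * φ b) with hF
  by_cases heℓ : Squarefree (e * ℓ)
  swap
  · -- every term vanishes
    have h0 : ∀ b ∈ Icc 1 Nb, truncGT (μ : ArithmeticFunction ℝ) (s * y) b *
        (if Squarefree (b * e * ℓ) then (sieveRho lam (b * e) : ℝ) * (μ ℓ : ℝ) * g (b * e * ℓ) * φ b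
          else 0) = 0 := by
      intro b _
      rw [if_neg, mul_zero]
      intro h
      apply heℓ
      have : b * e * ℓ = b * (e * ℓ) := by ring
      rw [this] at h
      exact Squarefree.of_mul_right h
    rw [Finset.sum_congr rfl h0, Finset.sum_const_zero, abs_zero]
    exact hRHS0
  have hesq : Squarefree e := Squarefree.of_mul_left heℓ
  have hℓsq : Squarefree ℓ := Squarefree.of_mul_right heℓ
  rw [if_pos hesq, if_pos hℓsq]
  -- Step 1: the summand, expanded
  have h1 : ∀ b ∈ Icc 1 Nb, truncGT (μ : ArithmeticFunction ℝ) (s * y) b *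
      (if Squarefree (b * e * ℓ) then (sieveRho lam (b * e) : ℝ) * (μ ℓ : ℝ) * g (b * e * ℓ) * φ b
        else 0) =
      (μ ℓ : ℝ) * g (e * ℓ) * ∑ ν₁ ∈ e.divisors, F b * ∑ ν₂ ∈ b.divisors, (lam (ν₁ * ν₂) : ℝ) := by
    intro b _
    rw [hF]
    dsimp only
    by_cases hsq : Squarefree (b * e * ℓ)
    · have hbe : Squarefree (b * e) := Squarefree.of_mul_left hsq
      have hsq' : Squarefree (b * (e * ℓ)) := by
        have : b * e * ℓ = b * (e * ℓ) := by ring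
        rwa [this] at hsq
      have hcop : b.Coprime (e * ℓ) := Nat.coprime_of_squarefree_mul hsq'
      rw [if_pos hsq, if_pos hsq, sieveRho_mul_of_squarefree lam hbe,
        show b * e * ℓ = b * (e * ℓ) by ring, hg.map_mul_of_coprime hcop, Finset.mul_sum]
      rw [Finset.sum_mul, Finset.sum_mul, Finset.sum_mul, Finset.mul_sum]
      refine Finset.sum_congr rfl fun ν₁ _ => ?_
      ring
    · rw [if_neg hsq, if_neg hsq]
      simp
  rw [Finset.sum_congr rfl h1, ← Finset.mul_sum, Finset.sum_comm, abs_mul]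
  -- Step 2: swap `b` and `ν₂`
  have h2 : ∀ ν₁ ∈ e.divisors, ∑ b ∈ Icc 1 Nb, F b * ∑ ν₂ ∈ b.divisors, (lam (ν₁ * ν₂) : ℝ) =
      ∑ ν₂ ∈ Icc 1 Nb, (lam (ν₁ * ν₂) : ℝ) * ∑ b' ∈ Icc 1 (Nb / ν₂), F (b' * ν₂) := by
    intro ν₁ _
    rw [sum_Icc_mul_sum_divisors_eq F (fun ν₂ => (lam (ν₁ * ν₂) : ℝ)) Nb]
    refine Finset.sum_congr rfl fun ν₂ _ => ?_
    rw [Finset.mul_sum]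
    exact Finset.sum_congr rfl fun b' _ => by ring
  rw [Finset.sum_congr rfl h2]
  -- Step 3: bound each `(ν₁, ν₂)` term
  have h3 : ∀ ν₁ ∈ e.divisors, ∀ ν₂ ∈ Icc 1 Nb,
      |(lam (ν₁ * ν₂) : ℝ) * ∑ b' ∈ Icc 1 (Nb / ν₂), F (b' * ν₂)| ≤
        (if Squarefree ν₂ then g ν₂ * sigmaHalf ν₂ else 0) * (sigmaHalf e * sigmaHalf ℓ * Cst) := by
    intro ν₁ hν₁ ν₂ hν₂
    have hν₂1 : 1 ≤ ν₂ := (Finset.mem_Icc.mp hν₂).1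
    have hν₁1 : 1 ≤ ν₁ := Nat.pos_of_mem_divisors hν₁
    have hR0 : 0 ≤ (if Squarefree ν₂ then g ν₂ * sigmaHalf ν₂ else 0) * (sigmaHalf e * sigmaHalf ℓ * Cst) := by
      refine mul_nonneg ?_ (mul_nonneg (mul_nonneg (le_trans zero_le_one (one_le_sigmaHalf e))
        (le_trans zero_le_one (one_le_sigmaHalf ℓ))) hCst0)
      split_ifs with h
      · exact mul_nonneg (hgsq0 ν₂ h) (le_trans zero_le_one (one_le_sigmaHalf ν₂))
      · exact le_rfl
    by_cases hlam : lam (ν₁ * ν₂) = 0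
    · rw [hlam, Int.cast_zero, zero_mul, abs_zero]; exact hR0
    -- `ν₁ν₂ ≤ Lw`, so `ν₂ ≤ Lw` and `⌊sy/ν₂⌋ ≥ a₀`
    have hle : ((ν₁ * ν₂ : ℕ) : ℝ) ≤ Lw := (hw.dvd_and_le_of_ne_zero _ hlam).2
    have hν₂L : (ν₂ : ℝ) ≤ Lw := by
      refine le_trans ?_ hle
      exact_mod_cast Nat.le_mul_of_pos_left ν₂ hν₁1
    have ha : a₀ ≤ ⌊s * y / ν₂⌋₊ := ha₀le ν₂ hν₂1 hν₂L
    have hu2 : 2 ≤ ⌊s * y / ν₂⌋₊ := ha₀.trans ha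
    have hbnd := abs_sum_bprime_nu_le hg hg0 h24 hν₂1 he hℓ hC hx hz hsy hu2 hnx (Nb / ν₂)
      (e := e) (ℓ := ℓ) (C₀ := C₀)
    rw [abs_mul]
    have hlam1 : |(lam (ν₁ * ν₂) : ℝ)| ≤ 1 := by exact_mod_cast hw.abs_le_one (ν₁ * ν₂)
    refine (mul_le_mul hlam1 hbnd (abs_nonneg _) zero_le_one).trans ?_
    rw [one_mul]
    -- compare the constants
    have hσ : sigmaHalf (ν₂ * e * ℓ) ≤ sigmaHalf ν₂ * sigmaHalf e * sigmaHalf ℓ :=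
      (sigmaHalf_mul_le _ _).trans (mul_le_mul_of_nonneg_right (sigmaHalf_mul_le _ _)
        (le_trans zero_le_one (one_le_sigmaHalf ℓ)))
    have ha₀' : (2 : ℝ) ≤ a₀ := by exact_mod_cast ha₀
    have hloga : 0 < Real.log a₀ := Real.log_pos (by linarith)
    have hlogle : Real.log a₀ ≤ Real.log (⌊s * y / ν₂⌋₊ : ℝ) :=
      Real.log_le_log (by linarith) (by exact_mod_cast ha)
    have hfrac : 2 * |K| * sigmaHalf (ν₂ * e * ℓ) / Real.log (⌊s * y / ν₂⌋₊ : ℝ) ^ 6 * Real.log x ≤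
        sigmaHalf ν₂ * (sigmaHalf e * sigmaHalf ℓ * Cst) := by
      rw [hCst]
      have h6 : Real.log a₀ ^ 6 ≤ Real.log (⌊s * y / ν₂⌋₊ : ℝ) ^ 6 :=
        pow_le_pow_left₀ hloga.le hlogle 6
      calc 2 * |K| * sigmaHalf (ν₂ * e * ℓ) / Real.log (⌊s * y / ν₂⌋₊ : ℝ) ^ 6 * Real.log x
          ≤ 2 * |K| * (sigmaHalf ν₂ * sigmaHalf e * sigmaHalf ℓ) / Real.log a₀ ^ 6 * Real.log x := by
            refine mul_le_mul_of_nonneg_right ?_ hlogx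
            calc 2 * |K| * sigmaHalf (ν₂ * e * ℓ) / Real.log (⌊s * y / ν₂⌋₊ : ℝ) ^ 6
                ≤ 2 * |K| * sigmaHalf (ν₂ * e * ℓ) / Real.log a₀ ^ 6 :=
                  div_le_div_of_nonneg_left (by have := one_le_sigmaHalf (ν₂ * e * ℓ); positivity)
                    (by positivity) h6
              _ ≤ 2 * |K| * (sigmaHalf ν₂ * sigmaHalf e * sigmaHalf ℓ) / Real.log a₀ ^ 6 :=
                  div_le_div_of_nonneg_right (mul_le_mul_of_nonneg_left hσ (by positivity))
                    (by positivity)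
        _ = sigmaHalf ν₂ * (sigmaHalf e * sigmaHalf ℓ * (2 * |K| * Real.log x / Real.log a₀ ^ 6)) := by
            field_simp
    split_ifs with hν₂sq
    · calc g ν₂ * (2 * |K| * sigmaHalf (ν₂ * e * ℓ) / Real.log (⌊s * y / ν₂⌋₊ : ℝ) ^ 6 * Real.log x)
          ≤ g ν₂ * (sigmaHalf ν₂ * (sigmaHalf e * sigmaHalf ℓ * Cst)) :=
            mul_le_mul_of_nonneg_left hfrac (hgsq0 ν₂ hν₂sq)
        _ = g ν₂ * sigmaHalf ν₂ * (sigmaHalf e * sigmaHalf ℓ * Cst) := by ring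
    · rw [zero_mul, zero_mul]
  -- Step 4: sum the bounds
  have hμℓ : |(μ ℓ : ℝ) * g (e * ℓ)| ≤ g e * g ℓ := by
    rw [abs_mul, hg.map_mul_of_coprime (Nat.coprime_of_squarefree_mul heℓ),
      abs_of_nonneg (mul_nonneg (hgsq0 e hesq) (hgsq0 ℓ hℓsq))]
    have : |(μ ℓ : ℝ)| ≤ 1 := by exact_mod_cast ArithmeticFunction.abs_moebius_le_one
    calc |(μ ℓ : ℝ)| * (g e * g ℓ) ≤ 1 * (g e * g ℓ) :=
          mul_le_mul_of_nonneg_right this (mul_nonneg (hgsq0 e hesq) (hgsq0 ℓ hℓsq))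
      _ = g e * g ℓ := one_mul _
  have hinner : |∑ ν₁ ∈ e.divisors, ∑ ν₂ ∈ Icc 1 Nb,
      (lam (ν₁ * ν₂) : ℝ) * ∑ b' ∈ Icc 1 (Nb / ν₂), F (b' * ν₂)| ≤
      (e.divisors.card : ℝ) * (Sgs * (sigmaHalf e * sigmaHalf ℓ * Cst)) := by
    refine (Finset.abs_sum_le_sum_abs _ _).trans ?_
    have hν₁ : ∀ ν₁ ∈ e.divisors, |∑ ν₂ ∈ Icc 1 Nb,
        (lam (ν₁ * ν₂) : ℝ) * ∑ b' ∈ Icc 1 (Nb / ν₂), F (b' * ν₂)| ≤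
        Sgs * (sigmaHalf e * sigmaHalf ℓ * Cst) := by
      intro ν₁ hν₁
      refine (Finset.abs_sum_le_sum_abs _ _).trans ((Finset.sum_le_sum fun ν₂ hν₂ =>
        h3 ν₁ hν₁ ν₂ hν₂).trans ?_)
      rw [← Finset.sum_mul]
      refine mul_le_mul_of_nonneg_right ?_ (mul_nonneg (mul_nonneg
        (le_trans zero_le_one (one_le_sigmaHalf e)) (le_trans zero_le_one (one_le_sigmaHalf ℓ))) hCst0)
      rw [hSgs, Finset.sum_filter]
      have hsub : Icc 1 Nb ⊆ Icc 1 X := Finset.Icc_subset_Icc_right hNb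
      refine Finset.sum_le_sum_of_subset_of_nonneg hsub fun ν _ _ => ?_
      split_ifs with h
      · exact mul_nonneg (hgsq0 ν h) (le_trans zero_le_one (one_le_sigmaHalf ν))
      · exact le_rfl
    calc ∑ ν₁ ∈ e.divisors, |∑ ν₂ ∈ Icc 1 Nb,
          (lam (ν₁ * ν₂) : ℝ) * ∑ b' ∈ Icc 1 (Nb / ν₂), F (b' * ν₂)|
        ≤ ∑ ν₁ ∈ e.divisors, Sgs * (sigmaHalf e * sigmaHalf ℓ * Cst) := Finset.sum_le_sum hν₁
      _ = (e.divisors.card : ℝ) * (Sgs * (sigmaHalf e * sigmaHalf ℓ * Cst)) := by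
          rw [Finset.sum_const, nsmul_eq_mul]
  calc |(μ ℓ : ℝ) * g (e * ℓ)| * |∑ ν₁ ∈ e.divisors, ∑ ν₂ ∈ Icc 1 Nb,
        (lam (ν₁ * ν₂) : ℝ) * ∑ b' ∈ Icc 1 (Nb / ν₂), F (b' * ν₂)|
      ≤ (g e * g ℓ) * ((e.divisors.card : ℝ) * (Sgs * (sigmaHalf e * sigmaHalf ℓ * Cst))) :=
        mul_le_mul hμℓ hinner (abs_nonneg _) (mul_nonneg (hgsq0 e hesq) (hgsq0 ℓ hℓsq))
    _ = g e * (e.divisors.card : ℝ) * sigmaHalf e * (g ℓ * sigmaHalf ℓ) * Cst * Sgs := by ring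

namespace SieveSequence

/-- `A(x) = ∑_{1 ≤ n ≤ x} a_n` under the size normalisation. [folklore] -/
theorem congrSum_one_eq_sum_Icc (A : SieveSequence) (x : ℝ) :
    A.congrSum 1 x = ∑ n ∈ Icc 1 ⌊x⌋₊, A.a n := by
  rw [congrSum, Finset.filter_true_of_mem fun n _ => one_dvd n]
  rfl

/-- **The main terms `S*(x; y, z)` of `S⁺`** (FI §8, (8.3): "Summing over all the other variables
trivially we find that the main term in (8.2) contributes to `S⁺(x; y, z)` an amount `S*(x; y, z)`
which satisfies `S*(x; y, z) ≪ A(x)(log x)⁻¹`"), explicit form: with `M(k) = ∑_{b∣k} μ(b > sy)`,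
weights of level `L_w`, `a₀ ≥ 2` below every `⌊sy/ν⌋`, `ν ≤ L_w`, `C₀ ≥ 1`, `z > 0`, `x ≥ 1`,
`|∑_{k,ℓ} [kℓ sqfree] M(k)ρ_kμ(ℓ) g(kℓ) ∑_{n ≤ x} φ_{k,ℓ}(n) a_n|
  ≤ A(x) · (∑^♭_e g(e)τ(e)σ_e)(∑^♭_ℓ g(ℓ)σ_ℓ)(∑^♭_ν g(ν)σ_ν) · 2|K| log x (log a₀)^{-6}`.
[cite: FriedlanderIwaniecASP1998, §8 (8.3)] -/
theorem abs_S3star_le (A : SieveSequence) (hsize : ∀ t, A.size t = A.congrSum 1 t)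
    (hg0 : ∀ p : ℕ, p.Prime → 0 ≤ A.density p) {K : ℝ}
    (h24 : ∀ ν : ℕ, 1 ≤ ν → ∀ y : ℝ, 2 ≤ y →
      |∑ d ∈ (Icc 1 ⌊y⌋₊).filter (fun d : ℕ => d.Coprime ν), (μ d : ℝ) * A.density d| ≤
        K * sigmaHalf ν / Real.log y ^ 6)
    {P Lw : ℝ} {lam : ℕ → ℤ} (hw : IsUpperSieveWeights P Lw lam) {C₀ : ℕ} (hC : 1 ≤ C₀)
    {x y z s : ℝ} (hx : 1 ≤ x) (hz : 0 < z) (hsy : 0 ≤ s * y)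
    {a₀ : ℕ} (ha₀ : 2 ≤ a₀) (ha₀le : ∀ ν : ℕ, 1 ≤ ν → (ν : ℝ) ≤ Lw → a₀ ≤ ⌊s * y / ν⌋₊) :
    |∑ k ∈ Icc 1 ⌊x⌋₊, ∑ ℓ ∈ Icc 1 (⌊x⌋₊ / k),
        (if Squarefree (k * ℓ) then
          (truncGT (μ : ArithmeticFunction ℝ) (s * y) * ζ) k * (sieveRho lam k : ℝ) * (μ ℓ : ℝ) *
            (A.density (k * ℓ) * ∑ n ∈ Icc 1 ⌊x⌋₊,
              (if (k : ℝ) * z < n ∧ (n : ℝ) ≤ k * (s * z) ∧ (n : ℝ) ≤ x then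
                Real.posLog ((n : ℝ) / ((k * ℓ * C₀ : ℕ) : ℝ)) else 0) * A.a n)
        else 0)| ≤
      A.size x *
        ((∑ e ∈ (Icc 1 ⌊x⌋₊).filter Squarefree,
            A.density e * (e.divisors.card : ℝ) * sigmaHalf e) *
          (∑ ℓ ∈ (Icc 1 ⌊x⌋₊).filter Squarefree, A.density ℓ * sigmaHalf ℓ) *
          (2 * |K| * Real.log x / Real.log a₀ ^ 6) *
          ∑ ν ∈ (Icc 1 ⌊x⌋₊).filter Squarefree, A.density ν * sigmaHalf ν) := by
  classical
  set X := ⌊x⌋₊ with hX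
  set g := A.density with hgdef
  have hg : g.IsMultiplicative := A.density_mult
  set μ' : ℕ → ℝ := fun b => truncGT (μ : ArithmeticFunction ℝ) (s * y) b with hμ'
  set φ : ℕ → ℕ → ℕ → ℝ := fun k ℓ n =>
    if (k : ℝ) * z < n ∧ (n : ℝ) ≤ k * (s * z) ∧ (n : ℝ) ≤ x then
      Real.posLog ((n : ℝ) / ((k * ℓ * C₀ : ℕ) : ℝ)) else 0 with hφ
  set Be : ℝ := ∑ e ∈ (Icc 1 X).filter Squarefree, g e * (e.divisors.card : ℝ) * sigmaHalf e with hBe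
  set Cst : ℝ := 2 * |K| * Real.log x / Real.log a₀ ^ 6 with hCst
  set Sgs : ℝ := ∑ ν ∈ (Icc 1 X).filter Squarefree, g ν * sigmaHalf ν with hSgs
  -- the inner function of `n`
  set inner : ℕ → ℝ := fun n => ∑ k ∈ Icc 1 X, ∑ ℓ ∈ Icc 1 (X / k),
    (if Squarefree (k * ℓ) then
      (truncGT (μ : ArithmeticFunction ℝ) (s * y) * ζ) k * (sieveRho lam k : ℝ) * (μ ℓ : ℝ) *
        g (k * ℓ) * φ k ℓ n else 0) with hinner
  -- Step 1: swap `n` outside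
  have hswap : ∑ k ∈ Icc 1 X, ∑ ℓ ∈ Icc 1 (X / k),
      (if Squarefree (k * ℓ) then
        (truncGT (μ : ArithmeticFunction ℝ) (s * y) * ζ) k * (sieveRho lam k : ℝ) * (μ ℓ : ℝ) *
          (g (k * ℓ) * ∑ n ∈ Icc 1 X, φ k ℓ n * A.a n) else 0) =
      ∑ n ∈ Icc 1 X, A.a n * inner n := by
    have h1 : ∀ k ∈ Icc 1 X, ∀ ℓ ∈ Icc 1 (X / k),
        (if Squarefree (k * ℓ) then
          (truncGT (μ : ArithmeticFunction ℝ) (s * y) * ζ) k * (sieveRho lam k : ℝ) * (μ ℓ : ℝ) *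
            (g (k * ℓ) * ∑ n ∈ Icc 1 X, φ k ℓ n * A.a n) else 0) =
        ∑ n ∈ Icc 1 X, A.a n * (if Squarefree (k * ℓ) then
          (truncGT (μ : ArithmeticFunction ℝ) (s * y) * ζ) k * (sieveRho lam k : ℝ) * (μ ℓ : ℝ) *
            g (k * ℓ) * φ k ℓ n else 0) := by
      intro k _ ℓ _
      split_ifs
      · rw [Finset.mul_sum, Finset.mul_sum]
        exact Finset.sum_congr rfl fun n _ => by ring
      · simp
    rw [Finset.sum_congr rfl fun k hk => Finset.sum_congr rfl fun ℓ hℓ => h1 k hk ℓ hℓ]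
    have h2 : ∀ k ∈ Icc 1 X, ∑ ℓ ∈ Icc 1 (X / k), ∑ n ∈ Icc 1 X, A.a n * (if Squarefree (k * ℓ) then
          (truncGT (μ : ArithmeticFunction ℝ) (s * y) * ζ) k * (sieveRho lam k : ℝ) * (μ ℓ : ℝ) *
            g (k * ℓ) * φ k ℓ n else 0) =
        ∑ n ∈ Icc 1 X, ∑ ℓ ∈ Icc 1 (X / k), A.a n * (if Squarefree (k * ℓ) then
          (truncGT (μ : ArithmeticFunction ℝ) (s * y) * ζ) k * (sieveRho lam k : ℝ) * (μ ℓ : ℝ) *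
            g (k * ℓ) * φ k ℓ n else 0) := fun k _ => Finset.sum_comm
    rw [Finset.sum_congr rfl h2, Finset.sum_comm]
    refine Finset.sum_congr rfl fun n _ => ?_
    rw [hinner]
    dsimp only
    rw [Finset.mul_sum]
    refine Finset.sum_congr rfl fun k _ => ?_
    rw [Finset.mul_sum]
  -- Step 2: the bound for `inner n`
  have hinner_le : ∀ n ∈ Icc 1 X, |inner n| ≤ Be * Sgs * Cst * Sgs := by
    intro n hn
    have hnx : (n : ℝ) ≤ x := by
      have := (Finset.mem_Icc.mp hn).2
      exact le_trans (by exact_mod_cast this) (Nat.floor_le (by linarith))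
    -- expand `M(k)` and reorder to `∑_e ∑_ℓ ∑_b`
    set G : ℕ → ℝ := fun k => ∑ ℓ ∈ Icc 1 (X / k),
      (if Squarefree (k * ℓ) then (sieveRho lam k : ℝ) * (μ ℓ : ℝ) * g (k * ℓ) * φ k ℓ n else 0)
      with hG
    have e1 : inner n = ∑ k ∈ Icc 1 X, G k * ∑ b ∈ k.divisors, μ' b := by
      rw [hinner, hG]
      dsimp only
      refine Finset.sum_congr rfl fun k _ => ?_
      rw [Finset.sum_mul]
      refine Finset.sum_congr rfl fun ℓ _ => ?_
      rw [ArithmeticFunction.coe_mul_zeta_apply]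
      split_ifs
      · ring
      · simp
    have e2 : ∑ k ∈ Icc 1 X, G k * ∑ b ∈ k.divisors, μ' b =
        ∑ e ∈ Icc 1 X, ∑ ℓ ∈ Icc 1 (X / e), ∑ b ∈ Icc 1 (X / e / ℓ), μ' b *
          (if Squarefree (b * e * ℓ) then (sieveRho lam (b * e) : ℝ) * (μ ℓ : ℝ) * g (b * e * ℓ) *
            (if (((b * e : ℕ)) : ℝ) * z < n ∧ (n : ℝ) ≤ ((b * e : ℕ) : ℝ) * (s * z) ∧ (n : ℝ) ≤ x then
              Real.posLog ((n : ℝ) / ((b * e * ℓ * C₀ : ℕ) : ℝ)) else 0) else 0) := by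
      rw [sum_Icc_mul_sum_divisors_eq G μ' X, sum_Icc_div_comm (fun e b => G (e * b) * μ' b) X]
      refine Finset.sum_congr rfl fun e _ => ?_
      have h3 : ∀ b ∈ Icc 1 (X / e), G (e * b) * μ' b =
          ∑ ℓ ∈ Icc 1 (X / e / b), μ' b *
            (if Squarefree (b * e * ℓ) then (sieveRho lam (b * e) : ℝ) * (μ ℓ : ℝ) * g (b * e * ℓ) *
              (if (((b * e : ℕ)) : ℝ) * z < n ∧ (n : ℝ) ≤ ((b * e : ℕ) : ℝ) * (s * z) ∧ (n : ℝ) ≤ x then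
                Real.posLog ((n : ℝ) / ((b * e * ℓ * C₀ : ℕ) : ℝ)) else 0) else 0) := by
        intro b _
        rw [hG, Finset.sum_mul, Nat.mul_comm e b, Nat.div_div_eq_div_mul, Nat.mul_comm e b]
        refine Finset.sum_congr rfl fun ℓ _ => ?_
        rw [hφ]
        dsimp only
        push_cast
        ring
      rw [Finset.sum_congr rfl h3, sum_Icc_div_comm (fun b ℓ => μ' b *
            (if Squarefree (b * e * ℓ) then (sieveRho lam (b * e) : ℝ) * (μ ℓ : ℝ) * g (b * e * ℓ) *
              (if (((b * e : ℕ)) : ℝ) * z < n ∧ (n : ℝ) ≤ ((b * e : ℕ) : ℝ) * (s * z) ∧ (n : ℝ) ≤ x then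
                Real.posLog ((n : ℝ) / ((b * e * ℓ * C₀ : ℕ) : ℝ)) else 0) else 0)) (X / e)]
    rw [e1, e2]
    -- bound each `(e, ℓ)`
    have hbnd : ∀ e ∈ Icc 1 X, ∀ ℓ ∈ Icc 1 (X / e),
        |∑ b ∈ Icc 1 (X / e / ℓ), μ' b *
          (if Squarefree (b * e * ℓ) then (sieveRho lam (b * e) : ℝ) * (μ ℓ : ℝ) * g (b * e * ℓ) *
            (if (((b * e : ℕ)) : ℝ) * z < n ∧ (n : ℝ) ≤ ((b * e : ℕ) : ℝ) * (s * z) ∧ (n : ℝ) ≤ x then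
              Real.posLog ((n : ℝ) / ((b * e * ℓ * C₀ : ℕ) : ℝ)) else 0) else 0)| ≤
        (if Squarefree e then g e * (e.divisors.card : ℝ) * sigmaHalf e else 0) *
          (if Squarefree ℓ then g ℓ * sigmaHalf ℓ else 0) * Cst * Sgs := by
      intro e he ℓ hℓ
      have he1 : 1 ≤ e := (Finset.mem_Icc.mp he).1
      have hℓ1 : 1 ≤ ℓ := (Finset.mem_Icc.mp hℓ).1
      have hNb : X / e / ℓ ≤ X := (Nat.div_le_self _ _).trans (Nat.div_le_self _ _)
      exact abs_Bsum_le hg hg0 h24 hw he1 hℓ1 hC hx hz hsy ha₀ ha₀le hnx hNb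
    have hterm0 : ∀ e ℓ : ℕ, 0 ≤ (if Squarefree e then g e * (e.divisors.card : ℝ) * sigmaHalf e else 0) *
        (if Squarefree ℓ then g ℓ * sigmaHalf ℓ else 0) := by
      intro e ℓ
      refine mul_nonneg ?_ ?_
      · split_ifs with h
        · exact mul_nonneg (mul_nonneg (ArithmeticFunction.IsMultiplicative.nonneg_of_squarefree hg hg0 h)
            (Nat.cast_nonneg _)) (le_trans zero_le_one (one_le_sigmaHalf e))
        · exact le_rfl
      · split_ifs with h
        · exact mul_nonneg (ArithmeticFunction.IsMultiplicative.nonneg_of_squarefree hg hg0 h)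
            (le_trans zero_le_one (one_le_sigmaHalf ℓ))
        · exact le_rfl
    have hCst0 : 0 ≤ Cst := by have := Real.log_nonneg hx; positivity
    have hSgs0 : 0 ≤ Sgs := Finset.sum_nonneg fun ν hν =>
      mul_nonneg (ArithmeticFunction.IsMultiplicative.nonneg_of_squarefree hg hg0 (Finset.mem_filter.mp hν).2)
        (le_trans zero_le_one (one_le_sigmaHalf ν))
    calc |∑ e ∈ Icc 1 X, ∑ ℓ ∈ Icc 1 (X / e), ∑ b ∈ Icc 1 (X / e / ℓ), μ' b *
          (if Squarefree (b * e * ℓ) then (sieveRho lam (b * e) : ℝ) * (μ ℓ : ℝ) * g (b * e * ℓ) *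
            (if (((b * e : ℕ)) : ℝ) * z < n ∧ (n : ℝ) ≤ ((b * e : ℕ) : ℝ) * (s * z) ∧ (n : ℝ) ≤ x then
              Real.posLog ((n : ℝ) / ((b * e * ℓ * C₀ : ℕ) : ℝ)) else 0) else 0)|
        ≤ ∑ e ∈ Icc 1 X, ∑ ℓ ∈ Icc 1 (X / e),
            (if Squarefree e then g e * (e.divisors.card : ℝ) * sigmaHalf e else 0) *
              (if Squarefree ℓ then g ℓ * sigmaHalf ℓ else 0) * Cst * Sgs := by
          refine (Finset.abs_sum_le_sum_abs _ _).trans (Finset.sum_le_sum fun e he => ?_)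
          exact (Finset.abs_sum_le_sum_abs _ _).trans (Finset.sum_le_sum fun ℓ hℓ => hbnd e he ℓ hℓ)
      _ ≤ ∑ e ∈ Icc 1 X, ∑ ℓ ∈ Icc 1 X,
            (if Squarefree e then g e * (e.divisors.card : ℝ) * sigmaHalf e else 0) *
              (if Squarefree ℓ then g ℓ * sigmaHalf ℓ else 0) * Cst * Sgs := by
          refine Finset.sum_le_sum fun e _ => ?_
          refine Finset.sum_le_sum_of_subset_of_nonneg
            (Finset.Icc_subset_Icc_right (Nat.div_le_self _ _)) fun ℓ _ _ => ?_
          exact mul_nonneg (mul_nonneg (hterm0 e ℓ) hCst0) hSgs0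
      _ = Be * Sgs * Cst * Sgs := by
          have hSgs' : ∑ ℓ ∈ Icc 1 X, (if Squarefree ℓ then g ℓ * sigmaHalf ℓ else 0) = Sgs := by
            rw [hSgs, Finset.sum_filter]
          rw [hBe, Finset.sum_filter, Finset.sum_mul, Finset.sum_mul, Finset.sum_mul]
          refine Finset.sum_congr rfl fun e _ => ?_
          rw [← Finset.sum_mul, ← Finset.sum_mul, ← Finset.mul_sum, hSgs']
  -- Step 3: conclude
  rw [hswap]
  have ha0 : ∀ n, 0 ≤ A.a n := A.a_nonneg
  calc |∑ n ∈ Icc 1 X, A.a n * inner n| ≤ ∑ n ∈ Icc 1 X, |A.a n * inner n| := Finset.abs_sum_le_sum_abs _ _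
    _ ≤ ∑ n ∈ Icc 1 X, A.a n * (Be * Sgs * Cst * Sgs) := by
        refine Finset.sum_le_sum fun n hn => ?_
        rw [abs_mul, abs_of_nonneg (ha0 n)]
        exact mul_le_mul_of_nonneg_left (hinner_le n hn) (ha0 n)
    _ = A.size x * (Be * Sgs * Cst * Sgs) := by
        rw [← Finset.sum_mul, hsize, A.congrSum_one_eq_sum_Icc]

end SieveSequence

end Literature.NumberTheory.Sieve
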